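import Literature.Computability.Cryptography.LiuPassCondEPPRG
import HarnessLib

/-!
# Liu–Pass, Thm 3.1 (a) ⇒ (c) for the tree's universal machine: Thm 5.2 applied to the padded cond EP-PRG of Thm 5.5

D-0014 companion (level 3) of `Sweep1Proofs.lean` / `LiuPassWeakOWF.lean` / `LiuPassCondEPPRG.lean`
for the named fact `Literature.Computability.Cryptography.OWFExist_iff_isMildlyHardOnAverage_liuPassKt`
(crypto-foundations.S02, Liu–Pass FOCS 2020, Thm 1.1 with the remark "for every polynomial
`t(n) ≥ (1+ε)n`"), direction `→`. `LiuPassCondEPPRG.lean` proves Liu–Pass's Thm 5.2 for a family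
of cond EP-PRGs whose outputs are *assumed* to have low `K^t`-complexity and leaves the input from
§5.3 as one composite fact (`condEPPRG_family_of_OWFExist`: Thm 5.6 + truncations + eq. (2), a
statement tailored to the tree). This file removes the tailoring: it **proves** the padding step
(print's Thm 5.6, "`G_γ(s₀ ‖ s₁) = s₀ ‖ G'(s₁)`") inside the argument of Thm 5.2 for the tree's
abstract efficient universal machine `Literature.Computability.MetaComplexity.UniversalMachine` (universality with a
machine-dependent polynomial simulation overhead, budgets counting `U`-steps), so that the forward
direction of S02 rests on **Thm 5.5 as printed** (`condEPPRG_of_OWFExist`: OWFs ⇒ `1/n^δ`-cond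
EP-PRGs `{0,1}^n → {0,1}^{n + γ log n}` for all `γ, δ > 1`) and two TM2 efficiency facts
(`passThrough_polyTime`: a polynomial-time map can be computed "in front of" an untouched suffix in
time independent of the suffix; `lpAdvRun_polyTime`: the distinguisher is polynomial-time).

* `padSeeds`, `padGen`, `mapEntropy_padSeeds` — the padded generator `(F ‖ id)` on
  `S ‖ {0,1}^b` and its entropy `H(F(U_S)) + b` (proof of Thm 5.6: padding costs no entropy);
* `lpAcc`, `padAcc`, `uAcc`, `gAcc` — acceptance probabilities of the threshold test
  `[ℋ(x) ≥ |x| - 3⌊log₂ n⌋]` on padded samples; `sum_lpAcc_div_card_le` (Claim 2 of the proof of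
  Thm 5.2 with the surprisal cap decoupled from the threshold), `gAcc_le` (Claim 2 for the padded
  generator), `le_uAcc` (Claim 1), `gap_ge` (the advantage `≥ 1/(2(α+1)n)`);
* `exists_candidate_of_le`, `frequently_exists_candidate` — the padded lengths
  `N + γ⌊log₂ n⌋`, `N ∈ [Q(n) - γ - 1, Q(n+1))`, cover all large `m`;
* `lpAdvRun`, `lpAdvDist`, `lpAdvDist_pr_eq` — the padding distinguisher: on `⟨1ⁿ, y⟩` it pads
  `y` with fresh coins to a good outer length and applies print's test; *which* outer length (and
  how many coins `ℋ` takes there) is read off the **number of its coins** (see "Deviations");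
* `not_frequently_good_of_inner` — Thm 5.2 for the padded generator (core);
* `condEPPRG_of_OWFExist` (Thm 5.5), `passThrough_polyTime`, `lpAdvRun_polyTime` — named facts;
* `isMildlyHardOnAverage_liuPassKt_of_OWFExist_of_padding` — OWFs ⇒ `K^t` mildly hard-on-average
  for every `U` and every polynomial `t(n) ≥ (1+ε)n`, from the three facts;
  `isMildlyHardOnAverage_liuPassKt_of_OWFExist_of_facts`,
  `exists_isMildlyHardOnAverage_liuPassKt_of_OWFExist_of_facts` — the level-1 facts of
  `Sweep1Proofs.lean` from the same; `OWFExist_iff_isMildlyHardOnAverage_liuPassKt_of_facts'` —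
  **S02 from six named facts** (two efficiency facts of Thm 4.1, Yao's amplification S05, Thm 5.5,
  two efficiency facts here), everything else being proved in `LiuPassWeakOWF.lean`,
  `LiuPassCondEPPRG.lean` and this file.

## The argument (proof of `isMildlyHardOnAverage_liuPassKt_of_OWFExist_of_padding`)

Let `F : {0,1}^n → {0,1}^{n + 6⌊log₂ n⌋}` be the `1/n²`-cond EP-PRG of Thm 5.5 (`γ = 6`, `δ = 2`),
`M` a pass-through machine for `F` with header `hdr(n)` (`|hdr(n)| ≤ 2⌊log₂ n⌋ + c`) and running
time `T(n)`, and `e, p` its code and simulation overhead on `U`. Put `Q(n) = p(T(n)) + n + 7`. For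
an outer seed length `N ∈ [Q(n) - 7, Q(n+1))` the padded generator `x ↦ F(x_{≤n}) ‖ x_{>n}` maps
`{0,1}^N` to `{0,1}^m`, `m = N + 6⌊log₂ n⌋`, has entropy `≥ N - α log₂ n` on `E_n ‖ {0,1}^{N-n}`,
and — the point of the padding — its outputs satisfy
`K^{t(m)}(F(s) ‖ τ) ≤ |hdr(n)| + N + 2|e| + 2 < m - 3⌊log₂ n⌋` as soon as
`⌊log₂ n⌋ > c + 2|e| + 2`, because the budget `t(m) ≥ m ≥ N ≥ p(T(n))` pays for simulating `M`
whatever the length of `τ` (`UniversalMachine.exists_ktAt_le_of_outputsWithin`, `ktAt_anti`); this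
is print's eq. (2) "`K^t(G(s)) ≤ n + O(1) ≤ m - γ/2 log n`". The ranges of consecutive `n` overlap,
so every large `m` is served. If a PPT `ℋ` computed `K^t` on a `1 - 1/p(m)` fraction of `U_m`,
`p(m) = m^{α+9} + 1`, for infinitely many `m`, then for infinitely many `n` some outer length
`N = Q(n) - 7 + i*(n)` is good, and the distinguisher `D(1ⁿ, y) = [ℋ(y ‖ τ) ≥ m - 3⌊log₂ n⌋]`
(`τ ← U_{N-n}`) has advantage `uAcc - gAcc ≥ 1/(2(α+1)n) ≥ 1/n²` between `U_{n + 6⌊log₂ n⌋}` and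
`F(U_n | E_n)` by Claims 1–2 of print's proof, contradicting Thm 5.5.

## Deviations from print (all documented at the declarations)

1. *Where the padding sits.* Print pads inside the generator (Thm 5.6, rate-1 efficiency, then
   Thm 5.2 for the padded `G_γ` at every length with `K^t(G_γ(s)) ≤ |s| + O(1)` from §2.2's
   step-counting convention). Here Thm 5.2's two claims are run directly for the padded generator
   relative to the *inner* `F`, the reduction to `F`'s pseudorandomness absorbing the padding (a
   uniform sample padded with uniform coins is uniform, `uniformAvg_padAcc`; the generator's output
   padded with uniform coins is the padded generator's output, `gAcc_eq_sum_padSeeds`); print's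
   rate-1 notion is not needed, and the outer lengths are grouped by the inner length they use
   (`exists_candidate_of_le`) instead of splitting every seed length as `n^{1/2c₀} + rest`.
2. *Advice through the coin count.* A uniform reduction must know which outer length `N` is good
   for `ℋ` at inner length `n` and how many coins `ℋ` uses on the padded length; in the tree's
   `Literature.Computability.Complexity.RandAlg` the coin budget `coinLen` is an arbitrary polynomially bounded function of
   the input length (it need not be computable, and `run` must be polynomial-time on all coin
   strings), so `D`'s budget `Q(n+1) + i·K(n) + κ` *encodes* the pair `(i, κ)` (`lpAdvCoins`,
   decoded by `lpOuter`/`lpKap` with `K(n)` exceeding every relevant coin count of `ℋ`), the first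
   `N - n` coins pad and the last `κ` coins drive `ℋ`. This is the same liberty by which
   `liuPassDist` (in `LiuPassCondEPPRG.lean`) gives `𝒜_ℋ` exactly `ℋ`'s budget; print's
   distinguisher needs no advice because print's lengths are fixed in advance.
3. *Threshold and constants.* Threshold `m - 3⌊log₂ n⌋` at the distinguisher's security parameter
   `n` (print: `m - (3γ/8) log n`, `γ ≥ 8`); stretch `γ = 6` and `δ = 2` in Thm 5.5; hardness
   polynomial `m^{α+9} + 1` (print: `2m^{2(α+γ+1)}`); Claim 2 in expectation form (no good-coins
   step), as in `LiuPassCondEPPRG.lean`.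
4. *Exact hardness only*, as in `LiuPassCondEPPRG.lean` (S02 asks for `IsMildlyHardOnAverage`, the
   case `d = 0` of print's "mildly hard-on-average to `(d log n)`-approximate").
5. *Thm 5.5 is used as printed but without its running-time clause* `(γ + δ) t₀(n)`:
   polynomial time (part of `IsCondEPPRG`) suffices here because the budget slack is created by the
   padding length `N ≥ p(T(n))`, not by rate-1 efficiency.

Theorem numbering follows arXiv:2009.11514v1 (Thm 3.1 and the remark after it = §3; Def 5.1,
Thm 5.2 with Claims 1–2 = §5.1–5.2; Lemmas 5.3–5.4, Thms 5.5–5.6 = §5.3; Thm 1.1).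

## References

* Y. Liu, R. Pass, *On one-way functions and Kolmogorov complexity*, FOCS 2020, 1243–1254;
  arXiv:2009.11514, §2.2, §3 (Thm 3.1 and remark), §5.2 (Thm 5.2 and its proof, Claims 1–2,
  eq. (2)), §5.3 (Thm 5.5, Thm 5.6 and their proofs), Thm 1.1. doi:10.1109/FOCS46700.2020.00118
* O. Goldreich, *Foundations of Cryptography I*, CUP 2001, §3.3–3.5 (PRGs from regular OWFs).
* S. Arora, B. Barak, *Computational Complexity: A Modern Approach*, CUP 2009, §1.2–1.3, Thm 1.9,
  §7.1.
* T. M. Cover, J. A. Thomas, *Elements of Information Theory*, 2nd ed., Wiley 2006, (2.14).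
-/

namespace Literature.Computability.Cryptography

open Filter _root_.Computability Complexity MetaComplexity Finset
open scoped ENNReal

section CoinSplitting

/-- Reading a coin string of length `a + b` as two consecutive fields. [folklore] -/
def vecSplitEquiv (a b : ℕ) : List.Vector Bool (a + b) ≃ List.Vector Bool a × List.Vector Bool b where
  toFun v := (⟨v.toList.take a, by simp⟩, ⟨v.toList.drop a, by simp⟩)
  invFun q := q.1 ++ q.2
  left_inv v := by
    obtain ⟨l, hl⟩ := v
    exact Subtype.ext (List.take_append_drop a l)
  right_inv q := by
    obtain ⟨⟨u, hu⟩, ⟨w, hw⟩⟩ := q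
    refine Prod.ext (Subtype.ext ?_) (Subtype.ext ?_)
    · show List.take a (u ++ w) = u
      exact List.take_left' hu
    · show List.drop a (u ++ w) = w
      exact List.drop_left' hu

/-- Splitting a sum over `{0,1}^{a+b}` into iterated sums over `{0,1}^a` and `{0,1}^b` (the coin
string read as two consecutive fields). [folklore] -/
theorem sum_vector_add {M : Type*} [AddCommMonoid M] (a b : ℕ) (φ : List Bool → List Bool → M) :
    ∑ v : List.Vector Bool (a + b), φ (v.toList.take a) (v.toList.drop a) =
      ∑ u : List.Vector Bool a, ∑ w : List.Vector Bool b, φ u.toList w.toList := by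
  rw [← Fintype.sum_prod_type' (f := fun (u : List.Vector Bool a) (w : List.Vector Bool b) => φ u.toList w.toList)]
  exact Fintype.sum_equiv (vecSplitEquiv a b) _ _ fun v => rfl

/-- The uniform average over `{0,1}^{a+b}` of a function of the two fields is the iterated
average. [folklore] -/
theorem uniformAvg_add (a b : ℕ) (φ : List Bool → List Bool → ℝ) :
    uniformAvg (a + b) (fun x => φ (x.take a) (x.drop a)) =
      uniformAvg a fun u => uniformAvg b fun w => φ u w := by
  unfold uniformAvg
  rw [sum_vector_add (M := ℝ) a b φ]
  simp only [Finset.sum_div, div_div, pow_add]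
  refine Finset.sum_congr rfl fun u _ => Finset.sum_congr rfl fun w _ => ?_
  rw [mul_comm]

end CoinSplitting

section AccBridge

variable {U : UniversalMachine} {t : Polynomial ℕ}

/-- Uniform averages only see `m`-bit strings. [folklore] -/
theorem uniformAvg_congr {m : ℕ} {f g : List Bool → ℝ} (h : ∀ x : List Bool, x.length = m → f x = g x) :
    uniformAvg m f = uniformAvg m g := by
  unfold uniformAvg
  congr 1
  exact Finset.sum_congr rfl fun x _ => h _ (by simp)

/-- `lpAcc ℋ N x = Pr_r[ℋ(x; r) ≥ |x| - 3⌊log₂ N⌋]`: the probability, over `ℋ`'s own coins, that the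
threshold test of Liu–Pass's distinguisher accepts `x` at security parameter `N`.
[Y. Liu, R. Pass, FOCS 2020, proof of Thm 5.2] [cite: LiuPassFOCS2020, Thm 5.2 (proof)] -/
noncomputable def lpAcc (H : RandAlg (List Bool) ℕ) (N : ℕ) (x : List Bool) : ℝ :=
  H.pr id x {v | lpThr N x.length ≤ v}

/-- `0 ≤ lpAcc`. [folklore] -/
theorem lpAcc_nonneg (H : RandAlg (List Bool) ℕ) (N : ℕ) (x : List Bool) : 0 ≤ lpAcc H N x :=
  H.pr_nonneg _ _ _

/-- `lpAcc ≤ 1`. [folklore] -/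
theorem lpAcc_le_one (H : RandAlg (List Bool) ℕ) (N : ℕ) (x : List Bool) : lpAcc H N x ≤ 1 :=
  H.pr_le_one _ _ _

/-- `lpAcc` as a normalised count over any coin length `κ = ℋ.coinLen |x|`. [folklore] -/
theorem lpAcc_eq_card_div (H : RandAlg (List Bool) ℕ) (N : ℕ) (x : List Bool) {κ : ℕ}
    (hκ : H.coinLen x.length = κ) :
    lpAcc H N x = ((Finset.univ.filter fun r : List.Vector Bool κ =>
      lpThr N x.length ≤ H.run x r.toList).card : ℝ) / 2 ^ κ := by
  classical
  unfold lpAcc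
  rw [H.pr_eq_card_filter_div id x {v | lpThr N x.length ≤ v} (by simpa using hκ)]
  simp only [Set.mem_setOf_eq]

/-- The distinguisher `𝒜_ℋ` accepts `⟨1^N, x⟩` with probability `lpAcc ℋ N x` whenever its coin
budget on that input is `ℋ`'s budget on `|x|`. [Y. Liu, R. Pass, FOCS 2020, proof of Thm 5.2]
[cite: LiuPassFOCS2020, Thm 5.2 (proof)] -/
theorem liuPassDist_pr_eq_lpAcc (H : RandAlg (List Bool) ℕ) (ℓ : ℕ → ℕ) {N : ℕ} (x : List Bool)
    (hcoin : (liuPassDist H ℓ).coinLen (2 * N + 2 + x.length) = H.coinLen x.length) :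
    (liuPassDist H ℓ).pr id (boolPair (unaryEncodeNat N) x) {true} = lpAcc H N x := by
  classical
  set κ := H.coinLen x.length with hκ
  have hDK : (liuPassDist H ℓ).coinLen (id (boolPair (unaryEncodeNat N) x)).length = κ := by
    simp only [id, length_boolPair, length_unaryEncodeNat]
    exact hcoin
  rw [(liuPassDist H ℓ).pr_eq_card_filter_div id _ {true} hDK, lpAcc_eq_card_div H N x rfl]
  congr 1
  rw [Nat.cast_inj]
  refine congr_arg Finset.card (Finset.filter_congr fun r _ => ?_)
  simp only [Set.mem_singleton_iff, liuPassDist, liuPassDistRun_boolPair, length_unaryEncodeNat,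
    decide_eq_true_eq]

/-- With the constant length function `ℓ ≡ m` the coin budget of `𝒜_ℋ` on `⟨1^N, x⟩`, `|x| = m`,
is `ℋ`'s on `m`-bit inputs, for every `N`. [folklore] -/
theorem liuPassDist_coinLen_const (H : RandAlg (List Bool) ℕ) (N m : ℕ) :
    (liuPassDist H fun _ => m).coinLen (2 * N + 2 + m) = H.coinLen m :=
  liuPassDist_coinLen H fun n' hn' => by omega

/-- Uniform side at one length, `lpAcc` form: for `16 ≤ N ≤ m` and `K^t` finite on `{0,1}^m`,
`Pr_{x ← U_m}[ℋ(x) = K^t(x)] - 8/N³ ≤ E_{x ← U_m}[lpAcc ℋ N x]`. [Y. Liu, R. Pass, FOCS 2020, proof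
of Thm 5.2, Claim 1] [cite: LiuPassFOCS2020, Thm 5.2 (proof, Claim 1)] -/
theorem avgSuccessProb_sub_le_uniformAvg_lpAcc (H : RandAlg (List Bool) ℕ) {N m n₀ : ℕ}
    (hN16 : 16 ≤ N) (hNm : N ≤ m) (hn₀ : n₀ ≤ N)
    (hfin : ∀ x : List Bool, n₀ ≤ x.length → U.ktAt (t.eval x.length) x < ⊤) :
    avgSuccessProb (liuPassKt U t) H m - 8 / (N : ℝ) ^ 3 ≤ uniformAvg m (lpAcc H N) := by
  have h := avgSuccessProb_sub_le_pr_uniform (U := U) (t := t) H (fun _ => m) (n := N) hN16 hNm hn₀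
    (liuPassDist_coinLen_const H N m) hfin
  rw [toReal_acceptPMF_uniformBits] at h
  refine h.trans_eq (uniformAvg_congr fun x hx => ?_)
  exact liuPassDist_pr_eq_lpAcc H _ x (by rw [hx]; exact liuPassDist_coinLen_const H N m)

end AccBridge

section ProductEntropy

/-- The seeds `S ‖ {0,1}^b = {s ‖ τ : s ∈ S, |τ| = b}` of a padded generator (print, proof of
Thm 5.5/5.6: "by taking 'extra' bits in the input and appending them to the output").
[Y. Liu, R. Pass, FOCS 2020, proofs of Thms 5.5–5.6] [cite: LiuPassFOCS2020, Thm 5.6 (proof)] -/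
def padSeeds (S : Finset (List Bool)) (b : ℕ) : Finset (List Bool) :=
  (S ×ˢ (Finset.univ : Finset (List.Vector Bool b))).image fun q => q.1 ++ q.2.toList

/-- The padded generator `x ↦ F(x_{≤ n}) ‖ x_{> n}`: apply `F` to the first `n` bits and pass the
rest through (print's `G'(x ‖ y) = G(x) ‖ y`). [Y. Liu, R. Pass, FOCS 2020, proofs of Thms 5.5–5.6]
[cite: LiuPassFOCS2020, Thm 5.6 (proof)] -/
def padGen (F : List Bool → List Bool) (n : ℕ) (x : List Bool) : List Bool :=
  F (x.take n) ++ x.drop n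

variable {S : Finset (List Bool)} {n : ℕ}

/-- Membership in `padSeeds`. [folklore] -/
theorem mem_padSeeds {b : ℕ} {x : List Bool} :
    x ∈ padSeeds S b ↔ ∃ s ∈ S, ∃ τ : List Bool, τ.length = b ∧ x = s ++ τ := by
  simp only [padSeeds, Finset.mem_image, Finset.mem_product, Finset.mem_univ, and_true, Prod.exists]
  constructor
  · rintro ⟨s, τ, hs, rfl⟩
    exact ⟨s, hs, τ.toList, by simp, rfl⟩
  · rintro ⟨s, hs, τ, hτ, rfl⟩
    exact ⟨s, ⟨τ, hτ⟩, hs, rfl⟩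

/-- The pairing `(s, τ) ↦ s ‖ τ` is injective on seeds of a fixed length. [folklore] -/
theorem padSeeds_injOn (hSlen : ∀ s ∈ S, s.length = n) (b : ℕ) :
    Set.InjOn (fun q : List Bool × List.Vector Bool b => q.1 ++ q.2.toList)
      ↑(S ×ˢ (Finset.univ : Finset (List.Vector Bool b))) := by
  rintro ⟨s, τ⟩ hq ⟨s', τ'⟩ hq' h
  simp only [Finset.coe_product, Finset.coe_univ, Set.mem_prod, Finset.mem_coe, Set.mem_univ,
    and_true] at hq hq'
  have hlen : s.length = s'.length := by rw [hSlen s hq, hSlen s' hq']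
  have h' : s ++ τ.toList = s' ++ τ'.toList := h
  obtain ⟨rfl, hτ⟩ := List.append_inj h' hlen
  simp only [Prod.mk.injEq, true_and]
  exact List.Vector.toList_injective hτ

/-- `|S ‖ {0,1}^b| = |S| · 2^b`. [folklore] -/
theorem card_padSeeds (hSlen : ∀ s ∈ S, s.length = n) (b : ℕ) :
    (padSeeds S b).card = S.card * 2 ^ b := by
  rw [padSeeds, Finset.card_image_of_injOn (padSeeds_injOn hSlen b), Finset.card_product,
    Finset.card_univ, card_vector, Fintype.card_bool]

/-- `S ‖ {0,1}^b` is nonempty when `S` is. [folklore] -/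
theorem padSeeds_nonempty (hS : S.Nonempty) (b : ℕ) : (padSeeds S b).Nonempty := by
  obtain ⟨s, hs⟩ := hS
  exact ⟨s ++ List.replicate b false, mem_padSeeds.2 ⟨s, hs, _, by simp, rfl⟩⟩

/-- Padded seeds have length `n + b`. [folklore] -/
theorem length_of_mem_padSeeds (hSlen : ∀ s ∈ S, s.length = n) {b : ℕ} {x : List Bool}
    (hx : x ∈ padSeeds S b) : x.length = n + b := by
  obtain ⟨s, hs, τ, hτ, rfl⟩ := mem_padSeeds.1 hx
  simp [hSlen s hs, hτ]

/-- The padded generator on a padded seed. [folklore] -/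
theorem padGen_append (F : List Bool → List Bool) {s : List Bool} (hs : s.length = n) (τ : List Bool) :
    padGen F n (s ++ τ) = F s ++ τ := by
  simp [padGen, List.take_left' hs, List.drop_left' hs]

/-- Sums over padded seeds are double sums. [folklore] -/
theorem sum_padSeeds {M : Type*} [AddCommMonoid M] (hSlen : ∀ s ∈ S, s.length = n) (b : ℕ)
    (f : List Bool → M) :
    ∑ x ∈ padSeeds S b, f x = ∑ s ∈ S, ∑ τ : List.Vector Bool b, f (s ++ τ.toList) := by
  rw [padSeeds, Finset.sum_image (padSeeds_injOn hSlen b), Finset.sum_product]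

/-- Fibres of the padded generator: if `F` has constant output length on `S` then the fibre of
`x ↦ F(x_{≤n}) ‖ x_{>n}` through `s ‖ τ` is `(fibre of F through s) ‖ τ`, of the same size.
[folklore] -/
theorem card_fiber_padGen (hSlen : ∀ s ∈ S, s.length = n) (F : List Bool → List Bool) {ℓ : ℕ}
    (hFlen : ∀ s ∈ S, (F s).length = ℓ) {b : ℕ} {s : List Bool} (hs : s ∈ S) (τ : List.Vector Bool b) :
    (fiber (padSeeds S b) (padGen F n) (padGen F n (s ++ τ.toList))).card =
      (fiber S F (F s)).card := by
  classical
  have himage : fiber (padSeeds S b) (padGen F n) (padGen F n (s ++ τ.toList)) =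
      (fiber S F (F s)).image fun s' => s' ++ τ.toList := by
    ext x
    simp only [mem_fiber, Finset.mem_image, mem_padSeeds]
    constructor
    · rintro ⟨⟨s', hs', τ', hτ', rfl⟩, hG⟩
      rw [padGen_append F (hSlen s' hs'), padGen_append F (hSlen s hs)] at hG
      have hl : (F s').length = (F s).length := by rw [hFlen s' hs', hFlen s hs]
      obtain ⟨hF, hτ⟩ := List.append_inj hG hl
      exact ⟨s', ⟨hs', hF⟩, by rw [hτ]⟩
    · rintro ⟨s', ⟨hs', hF⟩, rfl⟩
      refine ⟨⟨s', hs', τ.toList, by simp, rfl⟩, ?_⟩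
      rw [padGen_append F (hSlen s' hs'), padGen_append F (hSlen s hs), hF]
  rw [himage, Finset.card_image_of_injective]
  exact fun a b h => List.append_cancel_right h

/-- **Entropy of a padded generator**: `H((F ‖ id)(U_{S ‖ {0,1}^b})) = H(F(U_S)) + b` — the
pass-through bits add exactly their length (print, proof of Thm 5.6: "the entropy-loss of `G_γ` is
`α' log(n^{1/2c₀}) = α log n`", i.e. padding costs no entropy). [Y. Liu, R. Pass, FOCS 2020, proof
of Thm 5.6; Cover–Thomas (2.14)] [cite: LiuPassFOCS2020, Thm 5.6 (proof)] -/
theorem mapEntropy_padSeeds (hS : S.Nonempty) (hSlen : ∀ s ∈ S, s.length = n)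
    (F : List Bool → List Bool) {ℓ : ℕ} (hFlen : ∀ s ∈ S, (F s).length = ℓ) (b : ℕ) :
    mapEntropy (padSeeds S b) (padGen F n) = mapEntropy S F + b := by
  classical
  have hSpos : (0 : ℝ) < S.card := by exact_mod_cast hS.card_pos
  have h2b : (0 : ℝ) < 2 ^ b := by positivity
  unfold mapEntropy
  rw [card_padSeeds hSlen b, sum_padSeeds hSlen b]
  have hterm : ∀ s ∈ S, ∀ τ : List.Vector Bool b,
      Real.logb 2 (((S.card * 2 ^ b : ℕ) : ℝ) /
        (fiber (padSeeds S b) (padGen F n) (padGen F n (s ++ τ.toList))).card) =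
      Real.logb 2 ((S.card : ℝ) / (fiber S F (F s)).card) + b := by
    intro s hs τ
    rw [card_fiber_padGen hSlen F hFlen hs τ]
    have hFpos : (0 : ℝ) < (fiber S F (F s)).card := by exact_mod_cast card_fiber_pos F hs
    push_cast
    rw [mul_div_right_comm, Real.logb_mul (div_pos hSpos hFpos).ne' h2b.ne', Real.logb_pow,
      Real.logb_self_eq_one one_lt_two, mul_one]
  rw [Finset.sum_congr rfl fun s hs => Finset.sum_congr rfl fun τ _ => hterm s hs τ]
  simp only [Finset.sum_const, Finset.card_univ, card_vector, Fintype.card_bool, nsmul_eq_mul]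
  rw [← Finset.mul_sum, Finset.sum_add_distrib, Finset.sum_const, nsmul_eq_mul]
  push_cast
  field_simp

end ProductEntropy

section AvgLemmas

/-- The uniform average of a constant. [folklore] -/
theorem uniformAvg_const (e : ℕ) (c : ℝ) : uniformAvg e (fun _ => c) = c := by
  unfold uniformAvg
  rw [Finset.sum_const, Finset.card_univ, card_vector, Fintype.card_bool, nsmul_eq_mul]
  push_cast
  field_simp

/-- A function of a prefix of the coins: the remaining coins average out. [folklore] -/
theorem uniformAvg_take (κ e : ℕ) (f : List Bool → ℝ) :
    uniformAvg (κ + e) (fun r => f (r.take κ)) = uniformAvg κ f := by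
  have h := uniformAvg_add κ e (fun u _ => f u)
  simp only [uniformAvg_const] at h
  exact h

/-- A `RandAlg` acceptance probability as a uniform average of the indicator over the coins.
[Arora–Barak 2009, §7.1] [folklore] -/
theorem _root_.Literature.Computability.Complexity.RandAlg.pr_true_eq_uniformAvg {α : Type} (A : RandAlg α Bool)
    (ea : α → List Bool) (x : α) {κ : ℕ} (hκ : A.coinLen (ea x).length = κ) :
    A.pr ea x {true} = uniformAvg κ fun r => if A.run x r = true then 1 else 0 := by
  classical
  rw [A.pr_eq_card_filter_div ea x {true} hκ, uniformAvg]
  congr 1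
  rw [Finset.natCast_card_filter]
  refine Finset.sum_congr rfl fun r _ => ?_
  simp only [Set.mem_singleton_iff]

end AvgLemmas

section Params

/-- Output length `ℓ_F(n) = n + γ⌊log₂ n⌋` of the inner cond EP-PRG of Thm 5.5.
[Y. Liu, R. Pass, FOCS 2020, Thm 5.5] [cite: LiuPassFOCS2020, Thm 5.5] -/
def lpInner (γ n : ℕ) : ℕ := n + γ * Nat.log 2 n

/-- Smallest outer (padded-seed) length served by inner seed length `n`: `Q(n) - (γ + 1)`. [folklore] -/
def lpLo (γ : ℕ) (Q : ℕ → ℕ) (n : ℕ) : ℕ := Q n - (γ + 1)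

/-- Number of outer lengths served by inner length `n`: those in `[Q(n) - γ - 1, Q(n+1))`. [folklore] -/
def lpW (γ : ℕ) (Q : ℕ → ℕ) (n : ℕ) : ℕ := Q (n + 1) - lpLo γ Q n

/-- The threshold test `[ℋ(x; r) ≥ |x| - 3⌊log₂ N⌋]` of Liu–Pass's distinguisher, on explicit
coins. [Y. Liu, R. Pass, FOCS 2020, proof of Thm 5.2] [cite: LiuPassFOCS2020, Thm 5.2 (proof)] -/
def lpTest (H : RandAlg (List Bool) ℕ) (N : ℕ) (x r : List Bool) : Bool :=
  decide (lpThr N x.length ≤ H.run x r)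

/-- `lpInner γ` is monotone. [folklore] -/
theorem lpInner_mono (γ : ℕ) : Monotone (lpInner γ) := fun _ _ hab =>
  Nat.add_le_add hab (Nat.mul_le_mul_left γ (Nat.log_mono_right hab))

/-- The test on explicit coins of the right length averages to `lpAcc`. [folklore] -/
theorem uniformAvg_lpTest {H : RandAlg (List Bool) ℕ} (N : ℕ) (x : List Bool) {κ : ℕ}
    (hκ : H.coinLen x.length = κ) :
    uniformAvg κ (fun r => if lpTest H N x r = true then (1 : ℝ) else 0) = lpAcc H N x := by
  classical
  rw [lpAcc_eq_card_div H N x hκ, uniformAvg, Finset.natCast_card_filter]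
  congr 1
  refine Finset.sum_congr rfl fun r _ => ?_
  simp [lpTest]

end Params

section PadAcc

variable (H : RandAlg (List Bool) ℕ) (γ : ℕ)

/-- `padAcc ℋ n N y = E_{τ ← U_{N-n}}[lpAcc ℋ n (y ‖ τ)]`: acceptance of the padded sample, the
threshold `|y ‖ τ| - 3⌊log₂ n⌋` being set by the *inner* seed length `n` (the distinguisher's
security parameter, as in print). [folklore] -/
noncomputable def padAcc (n N : ℕ) (y : List Bool) : ℝ :=
  uniformAvg (N - n) fun τ => lpAcc H n (y ++ τ)

/-- `uAcc ℋ γ n N = E_{w ← U_m}[lpAcc ℋ n w]`, `m = ℓ_F(n) + (N - n)`: acceptance of a uniform sample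
of the padded length. [folklore] -/
noncomputable def uAcc (n N : ℕ) : ℝ :=
  uniformAvg (lpInner γ n + (N - n)) (lpAcc H n)

variable {H γ}

/-- `0 ≤ padAcc ≤ 1`. [folklore] -/
theorem padAcc_nonneg (n N : ℕ) (y : List Bool) : 0 ≤ padAcc H n N y :=
  uniformAvg_nonneg fun _ => lpAcc_nonneg _ _ _

/-- `padAcc ≤ 1`. [folklore] -/
theorem padAcc_le_one (n N : ℕ) (y : List Bool) : padAcc H n N y ≤ 1 :=
  uniformAvg_le_one fun _ => lpAcc_le_one _ _ _

/-- `0 ≤ uAcc`. [folklore] -/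
theorem uAcc_nonneg (n N : ℕ) : 0 ≤ uAcc H γ n N :=
  uniformAvg_nonneg fun _ => lpAcc_nonneg _ _ _

/-- `uAcc ≤ 1`. [folklore] -/
theorem uAcc_le_one (n N : ℕ) : uAcc H γ n N ≤ 1 :=
  uniformAvg_le_one fun _ => lpAcc_le_one _ _ _


/-- **On a uniform sample the padded sample is uniform**: `E_{y ← U_{ℓ_F(n)}}[padAcc(y)] = uAcc`.
[folklore] -/
theorem uniformAvg_padAcc (n N : ℕ) :
    uniformAvg (lpInner γ n) (fun y => padAcc H n N y) = uAcc H γ n N := by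
  unfold padAcc uAcc
  rw [← uniformAvg_add (lpInner γ n) (N - n) (fun y τ => lpAcc H n (y ++ τ))]
  exact congr_arg (uniformAvg _) (funext fun x => by rw [List.take_append_drop])

/-- `gAcc`: acceptance of the padded generator's output, `E_{s ← S}[padAcc(F s)]`. [folklore] -/
noncomputable def gAcc (H : RandAlg (List Bool) ℕ) (F : List Bool → List Bool) (S : Finset (List Bool))
    (n N : ℕ) : ℝ :=
  (∑ s ∈ S, padAcc H n N (F s)) / S.card

/-- **On the generator's output the padded sample is the padded generator's output**:
`E_{s ← S}[padAcc(F s)] = E_{x ← S ‖ {0,1}^{N-n}}[lpAcc((F ‖ id)(x))]`. [folklore] -/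
theorem gAcc_eq_sum_padSeeds {S : Finset (List Bool)} {n : ℕ}
    (hSlen : ∀ s ∈ S, s.length = n) (F : List Bool → List Bool) (N : ℕ) :
    gAcc H F S n N = (∑ x ∈ padSeeds S (N - n), lpAcc H n (padGen F n x)) / (padSeeds S (N - n)).card := by
  unfold gAcc padAcc uniformAvg
  rw [card_padSeeds hSlen, sum_padSeeds hSlen,
    Finset.sum_congr rfl fun s hs => Finset.sum_congr rfl fun τ _ =>
      congr_arg (lpAcc H n) (padGen_append F (hSlen s hs) _)]
  rw [← Finset.sum_div, div_div]
  push_cast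
  ring

/-- `gAcc ≤ 1`. [folklore] -/
theorem gAcc_le_one (F : List Bool → List Bool) {S : Finset (List Bool)} (hS : S.Nonempty) (n N : ℕ) :
    gAcc H F S n N ≤ 1 := by
  unfold gAcc
  rw [div_le_one (by exact_mod_cast hS.card_pos)]
  calc ∑ s ∈ S, padAcc H n N (F s) ≤ ∑ _s ∈ S, (1 : ℝ) := Finset.sum_le_sum fun s _ => padAcc_le_one _ _ _
    _ = S.card := by simp

end PadAcc

section OneCandidate

variable {U : UniversalMachine} {t : Polynomial ℕ}
variable {H : RandAlg (List Bool) ℕ} {γ : ℕ}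

/-- **Claim 2 of the proof of Thm 5.2, `lpAcc` form, with the surprisal cap decoupled from the
threshold.** Let `S` be a nonempty seed set and `G` a generator with `m`-bit outputs on `S`, all of
`f`-value below the threshold `m - 3⌊log₂ n⌋` (`f = K^t`), whose output surprises are at most `ν`
with average (entropy) `≥ ν - a`. Then
`E_{s ← S}[Pr_r[ℋ(G s; r) ≥ m - 3⌊log₂ n⌋]] ≤ a/(a+1) + 2^{a+1-ν} · 2^m · Pr_{x ← U_m}[ℋ(x) ≠ f(x)]`.
This is `sum_pr_liuPassDist_div_card_le` (the case `ν = n`, phrased for the distinguisher `𝒜_ℋ`)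
with the cap freed: for the padded generator the seeds have the outer length `N = ν` while the
threshold and the entropy deficiency `a = α log₂ n` refer to the inner length `n`. Same proof: per
coin string, acceptance of `y = G(s)` is a failure of `ℋ_r` at `y`, the counting core
`card_filter_div_card_le_of_mapEntropy` bounds the accepted fraction, and averaging over `r` turns
the failure count into `2^m · Pr[ℋ fails]`. [Y. Liu, R. Pass, FOCS 2020, proof of Thm 5.2,
Claim 2; arXiv:2009.11514, §5.2] [cite: LiuPassFOCS2020, Thm 5.2 (proof, Claim 2)] -/
theorem sum_lpAcc_div_card_le (H : RandAlg (List Bool) ℕ) (n : ℕ) {m : ℕ}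
    {S : Finset (List Bool)} (hS : S.Nonempty) (G : List Bool → List Bool)
    (hlen : ∀ s ∈ S, (G s).length = m)
    (f : List Bool → ℕ) (hlow : ∀ s ∈ S, f (G s) < lpThr n m) {ν a : ℝ} (ha : 0 ≤ a)
    (hX : ∀ v ∈ S, Real.logb 2 ((S.card : ℝ) / (fiber S G (G v)).card) ≤ ν)
    (hH : ν - a ≤ mapEntropy S G) :
    (∑ s ∈ S, lpAcc H n (G s)) / S.card
      ≤ a / (a + 1) + (2 : ℝ) ^ (a + 1 - ν) * (2 ^ m * (1 - avgSuccessProb f H m)) := by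
  classical
  set K := H.coinLen m with hKdef
  have hSpos : (0 : ℝ) < S.card := by exact_mod_cast hS.card_pos
  have h2K : (0 : ℝ) < 2 ^ K := by positivity
  -- Step 1: acceptance probabilities as coin counts
  have hpr : ∀ s ∈ S, lpAcc H n (G s) =
      (∑ r : List.Vector Bool K, if lpThr n m ≤ H.run (G s) r.toList then (1 : ℝ) else 0) / 2 ^ K := by
    intro s hs
    rw [lpAcc_eq_card_div H n (G s) (κ := K) (by rw [hlen s hs]), Finset.natCast_card_filter, hlen s hs]
  have hlhs : (∑ s ∈ S, lpAcc H n (G s)) / S.card =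
      (∑ r : List.Vector Bool K, ((S.filter fun s => lpThr n m ≤ H.run (G s) r.toList).card : ℝ)
        / S.card) / 2 ^ K := by
    rw [Finset.sum_congr rfl hpr, ← Finset.sum_div, Finset.sum_comm, ← Finset.sum_div, div_right_comm]
    congr 1
    congr 1
    refine Finset.sum_congr rfl fun r _ => ?_
    rw [Finset.natCast_card_filter]
  -- Step 2: the counting core, coin string by coin string
  have hcore : ∀ r : List.Vector Bool K,
      ((S.filter fun s => lpThr n m ≤ H.run (G s) r.toList).card : ℝ) / S.card ≤
        a / (a + 1) + (2 : ℝ) ^ (a + 1 - ν) *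
          ((Finset.univ.filter fun v : List.Vector Bool m => H.run v.toList r.toList ≠ f v.toList).card
            : ℝ) := by
    intro r
    refine (card_filter_div_card_le_of_mapEntropy hS G ha hX hH
      (fun y => lpThr n m ≤ H.run y r.toList)).trans ?_
    gcongr
    have hsub : (S.image G).filter (fun y => lpThr n m ≤ H.run y r.toList) ⊆
        (Finset.univ.filter fun v : List.Vector Bool m =>
          H.run v.toList r.toList ≠ f v.toList).image List.Vector.toList := by
      intro y hy
      simp only [Finset.mem_filter, Finset.mem_image] at hy ⊢
      obtain ⟨⟨s, hs, rfl⟩, hthr⟩ := hy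
      refine ⟨⟨G s, hlen s hs⟩, ⟨Finset.mem_univ _, ?_⟩, rfl⟩
      simp only [List.Vector.toList_mk]
      have := hlow s hs
      omega
    calc ((S.image G).filter fun y => lpThr n m ≤ H.run y r.toList).card
        ≤ ((Finset.univ.filter fun v : List.Vector Bool m =>
            H.run v.toList r.toList ≠ f v.toList).image List.Vector.toList).card :=
          Finset.card_le_card hsub
      _ ≤ _ := Finset.card_image_le
  -- Step 3: averaging the failure counts over the coins gives `2^m · Pr[ℋ fails]`
  have hfail : (∑ r : List.Vector Bool K,
      ((Finset.univ.filter fun v : List.Vector Bool m => H.run v.toList r.toList ≠ f v.toList).card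
        : ℝ)) / 2 ^ K = 2 ^ m * (1 - avgSuccessProb f H m) := by
    rw [two_pow_mul_one_sub_avgSuccessProb]
    simp_rw [Finset.natCast_card_filter]
    rw [Finset.sum_comm, Finset.sum_div]
    refine Finset.sum_congr rfl fun v _ => ?_
    have hHK : H.coinLen (id v.toList).length = K := by simp [hKdef]
    rw [H.pr_eq_card_filter_div id _ _ hHK, Finset.natCast_card_filter, eq_sub_iff_add_eq,
      ← add_div, ← Finset.sum_add_distrib]
    rw [div_eq_one_iff_eq h2K.ne']
    have : ∀ r : List.Vector Bool K, ((if H.run v.toList r.toList ≠ f v.toList then (1 : ℝ) else 0) +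
        if H.run v.toList r.toList ∈ ({f v.toList} : Set ℕ) then (1 : ℝ) else 0) = 1 := by
      intro r
      by_cases h : H.run v.toList r.toList = f v.toList <;> simp [h]
    rw [Finset.sum_congr rfl fun r _ => this r, Finset.sum_const, Finset.card_univ, card_vector,
      Fintype.card_bool, nsmul_eq_mul, mul_one]
    push_cast
    ring
  -- assemble
  rw [hlhs, div_le_iff₀ h2K]
  calc ∑ r : List.Vector Bool K, ((S.filter fun s => lpThr n m ≤ H.run (G s) r.toList).card : ℝ) / S.card
      ≤ ∑ r : List.Vector Bool K, (a / (a + 1) + (2 : ℝ) ^ (a + 1 - ν) *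
          ((Finset.univ.filter fun v : List.Vector Bool m =>
            H.run v.toList r.toList ≠ f v.toList).card : ℝ)) := Finset.sum_le_sum fun r _ => hcore r
    _ = 2 ^ K * (a / (a + 1)) + (2 : ℝ) ^ (a + 1 - ν) * ∑ r : List.Vector Bool K,
          ((Finset.univ.filter fun v : List.Vector Bool m =>
            H.run v.toList r.toList ≠ f v.toList).card : ℝ) := by
        rw [Finset.sum_add_distrib, Finset.sum_const, Finset.card_univ, card_vector,
          Fintype.card_bool, nsmul_eq_mul, Finset.mul_sum]
        push_cast
        rfl
    _ = (a / (a + 1) + (2 : ℝ) ^ (a + 1 - ν) * (2 ^ m * (1 - avgSuccessProb f H m))) * 2 ^ K := by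
        rw [← hfail]
        field_simp

/-- **The generator side for one candidate** (Claim 2 for the padded generator `F ‖ id` on
`S ‖ {0,1}^{N-n}`, threshold and entropy deficiency at the inner length `n`, surprisal cap at the
outer length `N`): `gAcc ≤ a/(a+1) + 2n^{α+γ} · Pr[ℋ fails on U_m]`, `a = α log₂ n`,
`m = ℓ_F(n) + N - n = N + γ⌊log₂ n⌋`, given the entropy of `F(U_S)` (padding adds exactly `N - n`,
`mapEntropy_padSeeds`) and the low `K^t`-complexity of the padded outputs,
`K^t(F(s) ‖ τ) + 3⌊log₂ n⌋ < m`. [Y. Liu, R. Pass, FOCS 2020, proof of Thm 5.2, Claim 2, with the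
padding of Thms 5.5–5.6] [cite: LiuPassFOCS2020, Thm 5.2 (proof, Claim 2)] -/
theorem gAcc_le {S : Finset (List Bool)} (hS : S.Nonempty) {n N α : ℕ} (hSlen : ∀ s ∈ S, s.length = n)
    (hn0 : 0 < n) (hnN : n ≤ N) (F : List Bool → List Bool)
    (hFlen : ∀ s : List Bool, s.length = n → (F s).length = lpInner γ n)
    (hent : (n : ℝ) - α * Real.logb 2 n ≤ mapEntropy S F)
    (hK : ∀ s ∈ S, ∀ τ : List Bool, τ.length = N - n →
      liuPassKt U t (F s ++ τ) + 3 * Nat.log 2 n < lpInner γ n + (N - n)) :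
    gAcc H F S n N ≤ α * Real.logb 2 n / (α * Real.logb 2 n + 1) +
      2 * (n : ℝ) ^ (α + γ) * (1 - avgSuccessProb (liuPassKt U t) H (lpInner γ n + (N - n))) := by
  set L := Nat.log 2 n with hL
  set m := lpInner γ n + (N - n) with hm
  set S' := padSeeds S (N - n) with hS'
  have h2L : 2 ^ L ≤ n := Nat.pow_log_le_self 2 hn0.ne'
  have hmN : m = N + γ * L := by simp only [hm, lpInner, ← hL]; omega
  have hS'ne : S'.Nonempty := padSeeds_nonempty hS _
  have hS'len : ∀ x ∈ S', x.length = N := fun x hx => by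
    have := length_of_mem_padSeeds hSlen hx
    omega
  have hFlenS : ∀ s ∈ S, (F s).length = lpInner γ n := fun s hs => hFlen s (hSlen s hs)
  have hlen' : ∀ x ∈ S', (padGen F n x).length = m := by
    intro x hx
    obtain ⟨s, hs, τ, hτ, rfl⟩ := mem_padSeeds.1 hx
    rw [padGen_append F (hSlen s hs), List.length_append, hFlenS s hs, hτ]
  -- surprisal cap `N`, entropy `≥ N - α log₂ n`
  have hS'le : S'.card ≤ 2 ^ N := card_le_two_pow_of_length_eq hS'len
  have hX : ∀ v ∈ S', Real.logb 2 ((S'.card : ℝ) / (fiber S' (padGen F n) (padGen F n v)).card) ≤ N :=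
    fun v hv => logb_card_div_card_fiber_le_of_card_le (padGen F n) hv hS'le
  have hent' : (N : ℝ) - α * Real.logb 2 n ≤ mapEntropy S' (padGen F n) := by
    rw [hS', mapEntropy_padSeeds hS hSlen F hFlenS]
    have hcast : ((N - n : ℕ) : ℝ) = N - n := by rw [Nat.cast_sub hnN]
    rw [hcast]
    linarith
  have hKG' : ∀ x ∈ S', liuPassKt U t (padGen F n x) < lpThr n m := by
    intro x hx
    obtain ⟨s, hs, τ, hτ, rfl⟩ := mem_padSeeds.1 hx
    rw [padGen_append F (hSlen s hs)]
    have := hK s hs τ hτ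
    show liuPassKt U t (F s ++ τ) < m - 3 * L
    omega
  have h1n : (1 : ℝ) ≤ n := by exact_mod_cast hn0
  have hlogb0 : 0 ≤ Real.logb 2 n := Real.logb_nonneg one_lt_two h1n
  set a : ℝ := α * Real.logb 2 n with ha
  have ha0 : 0 ≤ a := mul_nonneg (Nat.cast_nonneg _) hlogb0
  have hC := sum_lpAcc_div_card_le H n hS'ne (padGen F n) hlen' (liuPassKt U t) hKG' (ν := N) ha0 hX hent'
  have hpowbound : (2 : ℝ) ^ (a + 1 - N) * 2 ^ m ≤ 2 * (n : ℝ) ^ (α + γ) := by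
    have e1 : (2 : ℝ) ^ (a + 1 - N) = 2 ^ a * 2 / 2 ^ N := by
      rw [Real.rpow_sub two_pos, Real.rpow_add two_pos, Real.rpow_one, Real.rpow_natCast]
    have e2 : (2 : ℝ) ^ a = (n : ℝ) ^ α := two_rpow_natCast_mul_logb α hn0
    have e3 : (2 : ℝ) ^ m = 2 ^ N * 2 ^ (γ * L) := by rw [← pow_add, hmN]
    have e4 : (2 : ℝ) ^ (γ * L) ≤ (n : ℝ) ^ γ := by
      calc (2 : ℝ) ^ (γ * L) = (2 ^ L) ^ γ := by rw [mul_comm, pow_mul]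
        _ ≤ (n : ℝ) ^ γ := by
            gcongr
            exact_mod_cast h2L
    rw [e1, e2, e3]
    have h2N : (0 : ℝ) < 2 ^ N := by positivity
    calc (n : ℝ) ^ α * 2 / 2 ^ N * (2 ^ N * 2 ^ (γ * L)) = 2 * (n : ℝ) ^ α * 2 ^ (γ * L) := by
          field_simp
      _ ≤ 2 * (n : ℝ) ^ α * (n : ℝ) ^ γ := by gcongr
      _ = 2 * (n : ℝ) ^ (α + γ) := by rw [pow_add]; ring
  have h1mavg : 0 ≤ 1 - avgSuccessProb (liuPassKt U t) H m :=
    sub_nonneg.2 (avgSuccessProb_le_one _ _ _)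
  rw [gAcc_eq_sum_padSeeds hSlen F N]
  calc (∑ x ∈ S', lpAcc H n (padGen F n x)) / S'.card
      ≤ a / (a + 1) + (2 : ℝ) ^ (a + 1 - N) * (2 ^ m * (1 - avgSuccessProb (liuPassKt U t) H m)) := hC
    _ = a / (a + 1) + ((2 : ℝ) ^ (a + 1 - N) * 2 ^ m) * (1 - avgSuccessProb (liuPassKt U t) H m) := by
        ring
    _ ≤ a / (a + 1) + (2 * (n : ℝ) ^ (α + γ)) * (1 - avgSuccessProb (liuPassKt U t) H m) := by
        gcongr

/-- **The uniform side for one candidate** (Claim 1, threshold at the inner length `n ≤ m`):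
`uAcc ≥ Pr[ℋ right on U_m] - 8/n³`. [Y. Liu, R. Pass, FOCS 2020, proof of Thm 5.2, Claim 1]
[cite: LiuPassFOCS2020, Thm 5.2 (proof, Claim 1)] -/
theorem le_uAcc {n N n₀ : ℕ} (hn16 : 16 ≤ n) (hn₀ : n₀ ≤ n)
    (hfin : ∀ x : List Bool, n₀ ≤ x.length → U.ktAt (t.eval x.length) x < ⊤) :
    avgSuccessProb (liuPassKt U t) H (lpInner γ n + (N - n)) - 8 / (n : ℝ) ^ 3 ≤ uAcc H γ n N := by
  have hnm : n ≤ lpInner γ n + (N - n) := by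
    show n ≤ n + γ * Nat.log 2 n + (N - n)
    omega
  exact avgSuccessProb_sub_le_uniformAvg_lpAcc H hn16 hnm hn₀ hfin

/-- **The gap at a good length**: if `ℋ` is right on `U_m` with probability `S₀ > 1 - 1/P`,
`P > N^{e+3}`, and `u ≥ S₀ - 8/N³`, `g ≤ a/(a+1) + 2N^{e}(1 - S₀)` with `0 ≤ a`, `a + 1 ≤ (α+1)N`,
then for `N ≥ 22(α+1)` the gap `u - g` is at least `1/(2(α+1)N)` (print: "`≥ 1/n - 4/n² ≥ 1/n²`";
here `u - g ≥ 1/((α+1)N) - 11/N³`). [Y. Liu, R. Pass, FOCS 2020, proof of Thm 5.2 (conclusion)]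
[cite: LiuPassFOCS2020, Thm 5.2 (proof)] -/
theorem gap_ge {u g S₀ P a : ℝ} {N α e : ℕ} (hN : 22 * (α + 1) ≤ N)
    (ha : 0 ≤ a) (ha1 : a + 1 ≤ ((α : ℝ) + 1) * N)
    (hP : (N : ℝ) ^ (e + 3) < P) (hS₀ : 1 - 1 / P < S₀)
    (hu : S₀ - 8 / (N : ℝ) ^ 3 ≤ u) (hg : g ≤ a / (a + 1) + 2 * (N : ℝ) ^ e * (1 - S₀)) :
    1 / (2 * ((α : ℝ) + 1) * N) ≤ u - g := by
  have hN1 : (1 : ℝ) ≤ N := by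
    have : 1 ≤ N := le_trans (by omega) hN
    exact_mod_cast this
  have hNpos : (0 : ℝ) < N := by linarith
  have hN3 : (0 : ℝ) < (N : ℝ) ^ 3 := by positivity
  have hNe : (1 : ℝ) ≤ (N : ℝ) ^ e := one_le_pow₀ hN1
  have hPpos : 0 < P := lt_of_le_of_lt (by positivity) hP
  have hP3 : 1 / P ≤ 1 / (N : ℝ) ^ 3 := by
    refine one_div_le_one_div_of_le hN3 (le_trans ?_ hP.le)
    calc (N : ℝ) ^ 3 = (N : ℝ) ^ 3 * 1 := (mul_one _).symm
      _ ≤ (N : ℝ) ^ 3 * (N : ℝ) ^ e := by gcongr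
      _ = (N : ℝ) ^ (e + 3) := by ring
  have hPe : 2 * (N : ℝ) ^ e * (1 / P) ≤ 2 / (N : ℝ) ^ 3 := by
    have h1 : 1 / P ≤ 1 / (N : ℝ) ^ (e + 3) := one_div_le_one_div_of_le (by positivity) hP.le
    calc 2 * (N : ℝ) ^ e * (1 / P) ≤ 2 * (N : ℝ) ^ e * (1 / (N : ℝ) ^ (e + 3)) :=
          mul_le_mul_of_nonneg_left h1 (by positivity)
      _ = 2 / (N : ℝ) ^ 3 := by rw [pow_add]; field_simp
  have h1S : 1 - S₀ < 1 / P := by linarith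
  have hu9 : 1 - 9 / (N : ℝ) ^ 3 ≤ u := by
    have e8 : 8 / (N : ℝ) ^ 3 = 8 * (1 / (N : ℝ) ^ 3) := by ring
    have e9 : 9 / (N : ℝ) ^ 3 = 9 * (1 / (N : ℝ) ^ 3) := by ring
    linarith
  have hg2 : g ≤ a / (a + 1) + 2 / (N : ℝ) ^ 3 := by
    have : 2 * (N : ℝ) ^ e * (1 - S₀) ≤ 2 * (N : ℝ) ^ e * (1 / P) :=
      mul_le_mul_of_nonneg_left h1S.le (by positivity)
    linarith
  have ha1pos : 0 < a + 1 := by linarith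
  have hαN : 0 < ((α : ℝ) + 1) * N := by positivity
  have hinv : 1 / (((α : ℝ) + 1) * N) ≤ 1 / (a + 1) := one_div_le_one_div_of_le ha1pos ha1
  have hone : 1 - a / (a + 1) = 1 / (a + 1) := by field_simp; ring
  have hN22 : (22 : ℝ) * ((α : ℝ) + 1) ≤ N := by exact_mod_cast hN
  have h11 : 11 / (N : ℝ) ^ 3 ≤ 1 / (2 * ((α : ℝ) + 1) * N) := by
    rw [div_le_div_iff₀ hN3 (by positivity)]
    have : (N : ℝ) ^ 3 = N * (N * N) := by ring
    rw [this]
    have hNN : (22 : ℝ) * ((α : ℝ) + 1) * 1 ≤ N * N := by nlinarith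
    nlinarith
  have e11 : (11 : ℝ) / (N : ℝ) ^ 3 = 9 / (N : ℝ) ^ 3 + 2 / (N : ℝ) ^ 3 := by ring
  have hsplit : 1 / (((α : ℝ) + 1) * N) = 1 / (2 * ((α : ℝ) + 1) * N) + 1 / (2 * ((α : ℝ) + 1) * N) := by
    field_simp
    ring
  linarith

end OneCandidate

section Cover

/-- **The candidate ranges cover all large lengths.** With `lo(n) = Q(n) - γ - 1 + γ⌊log₂ n⌋`
(the smallest padded length served by inner length `n`) and `Q(n) ≥ n + γ + 1` for `n ≥ n₁`, every
`m ≥ lo(n₁)` is a padded length `ℓ_F(n) + (N - n)` for some `n ≥ n₁` and some candidate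
`N = Q(n) - γ - 1 + i`, `i < W(n)`: consecutive ranges `[lo(n), Q(n+1) + γ⌊log₂ n⌋)` overlap since
`⌊log₂ (n+1)⌋ ≤ ⌊log₂ n⌋ + 1`. (Print pads to *every* length by splitting the seed; here the outer
lengths are grouped by the inner length they use.) [folklore; cf. Y. Liu, R. Pass, FOCS 2020,
proof of Thm 5.6] [cite: LiuPassFOCS2020, Thm 5.6 (proof)] -/
theorem exists_candidate_of_le (γ : ℕ) (Q : ℕ → ℕ) {n₁ : ℕ} (hQ : ∀ n, n₁ ≤ n → n + (γ + 1) ≤ Q n)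
    {m : ℕ} (hm : lpLo γ Q n₁ + γ * Nat.log 2 n₁ ≤ m) :
    ∃ n, n₁ ≤ n ∧ ∃ i < lpW γ Q n, lpInner γ n + (lpLo γ Q n + i - n) = m := by
  classical
  -- the first `n ≥ n₁` whose successor range starts beyond `m`
  have hex : ∃ n, n₁ ≤ n ∧ m < lpLo γ Q (n + 1) + γ * Nat.log 2 (n + 1) := by
    refine ⟨max n₁ m, le_max_left _ _, ?_⟩
    have h1 := hQ (max n₁ m + 1) (by omega)
    have h2 : m ≤ max n₁ m := le_max_right _ _
    simp only [lpLo]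
    omega
  set n := Nat.find hex with hn
  obtain ⟨hn₁, hlt⟩ : n₁ ≤ n ∧ m < lpLo γ Q (n + 1) + γ * Nat.log 2 (n + 1) := Nat.find_spec hex
  have hlo : lpLo γ Q n + γ * Nat.log 2 n ≤ m := by
    by_cases heq : n = n₁
    · rw [heq]; exact hm
    · have hlt' : n₁ < n := lt_of_le_of_ne hn₁ (Ne.symm heq)
      have hmin := Nat.find_min hex (show n - 1 < n by omega)
      rw [not_and, not_lt] at hmin
      have := hmin (by omega)
      rwa [show n - 1 + 1 = n by omega] at this
  have hQn := hQ n hn₁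
  have hQn1 := hQ (n + 1) (by omega)
  have hlog := log_two_succ_le n
  refine ⟨n, hn₁, m - (lpLo γ Q n + γ * Nat.log 2 n), ?_, ?_⟩
  · simp only [lpW, lpLo] at hlt hlo ⊢
    have : γ * Nat.log 2 (n + 1) ≤ γ * (Nat.log 2 n + 1) := Nat.mul_le_mul_left γ hlog
    rw [Nat.mul_succ] at this
    omega
  · simp only [lpInner, lpLo] at hlo ⊢
    omega

/-- From "good at infinitely many lengths `m`" to "good at a candidate of infinitely many inner
lengths `n`". [folklore] -/
theorem frequently_exists_candidate (γ : ℕ) (Q : ℕ → ℕ) {n₁ : ℕ}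
    (hQ : ∀ n, n₁ ≤ n → n + (γ + 1) ≤ Q n) {P : ℕ → Prop} (hP : ∃ᶠ m in atTop, P m) :
    ∃ᶠ n in atTop, ∃ i < lpW γ Q n, P (lpInner γ n + (lpLo γ Q n + i - n)) := by
  rw [Filter.frequently_atTop] at hP ⊢
  intro N₀
  -- beyond all ranges of the inner lengths `< N₀`
  set M := (Finset.range N₀).sup (fun n => Q (n + 1) + γ * Nat.log 2 n) +
    (lpLo γ Q n₁ + γ * Nat.log 2 n₁) with hM
  obtain ⟨m, hmM, hPm⟩ := hP M
  obtain ⟨n, hn₁, i, hi, heq⟩ := exists_candidate_of_le γ Q hQ (m := m) (le_of_add_le_right hmM)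
  refine ⟨n, ?_, i, hi, heq ▸ hPm⟩
  by_contra hlt
  rw [not_le] at hlt
  have hsup : Q (n + 1) + γ * Nat.log 2 n ≤ (Finset.range N₀).sup (fun n => Q (n + 1) + γ * Nat.log 2 n) :=
    Finset.le_sup (f := fun n => Q (n + 1) + γ * Nat.log 2 n) (Finset.mem_range.2 hlt)
  have hQn := hQ n hn₁
  simp only [lpW, lpLo, lpInner] at hi heq
  omega

end Cover

section AdviceDistinguisher

/-- The outer length selected by the coin count `C` at inner length `n`:
`Q(n) - γ - 1 + ⌊(C - Q(n+1)) / K(n)⌋`. [folklore] -/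
def lpOuter (γ : ℕ) (Q K : ℕ → ℕ) (n C : ℕ) : ℕ := lpLo γ Q n + (C - Q (n + 1)) / K n

/-- `ℋ`'s coin count selected by the coin count `C` at inner length `n`: `(C - Q(n+1)) mod K(n)`.
[folklore] -/
def lpKap (Q K : ℕ → ℕ) (n C : ℕ) : ℕ := (C - Q (n + 1)) % K n

variable (H : RandAlg (List Bool) ℕ) (γ : ℕ) (Q K adv : ℕ → ℕ)

/-- **The padding distinguisher, deterministic core.** On input `⟨1ⁿ, y⟩` with coins `r`: decode
from the *number* of coins `C = |r|` an outer length `N = lpOuter n C` and a coin count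
`κ = lpKap n C`, pad the sample with the first `N - n` coins, `x = y ‖ r_{< N-n}`, and run
Liu–Pass's threshold test `[ℋ(x; ρ) ≥ |x| - 3⌊log₂ n⌋]` (print's `𝒜(1ⁿ, x)`, threshold set by the
security parameter `n`) with `ρ` the last `κ` coins. In the tree's model of randomized algorithms
(`Literature.Computability.Complexity.RandAlg`: the coin budget is an arbitrary polynomially bounded function of the input
length) the coin count can carry the `O(log n)` bits of advice "which padded length is good for
`ℋ`, and how many coins `ℋ` uses there" (`lpAdvDist`); this replaces print's fixed choice of
lengths (rate-1 padding, §2.2's step-counting universal machine), which is not available for the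
tree's abstract `UniversalMachine`. [Y. Liu, R. Pass, FOCS 2020, proof of Thm 5.2 (the
distinguisher) with the padding of the proofs of Thms 5.5–5.6] [cite: LiuPassFOCS2020, Thm 5.2 (proof)] -/
def lpAdvRun (z r : List Bool) : Bool :=
  lpTest H (boolUnpair z).1.length
    ((boolUnpair z).2 ++
      r.take (lpOuter γ Q K (boolUnpair z).1.length r.length - (boolUnpair z).1.length))
    (r.drop (r.length - lpKap Q K (boolUnpair z).1.length r.length))

/-- The coin count of the padding distinguisher at inner length `n` for the advice `adv(n)` (an
index `i`, selecting the outer length `N = Q(n) - γ - 1 + i`): `Q(n+1)` padding coins, then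
`i · K(n) + (ℋ's coin count on the padded length)` further coins. [folklore] -/
def lpAdvCoins (n : ℕ) : ℕ :=
  Q (n + 1) + adv n * K n + H.coinLen (lpInner γ n + (lpLo γ Q n + adv n - n))

/-- **The padding distinguisher** `D = D_{ℋ, γ, Q, K, adv}` as a randomized algorithm: run
`lpAdvRun`; coin budget `lpAdvCoins (adv)` at the inner length read off the input length
(`lpSeedOf (lpInner γ)`). The advice function `adv` is a parameter (in the proof of Thm 5.2 it is
chosen, non-constructively, as a good outer length for `ℋ`). [Y. Liu, R. Pass, FOCS 2020, proof of
Thm 5.2, adapted to the tree's `RandAlg`/`UniversalMachine` model] [cite: LiuPassFOCS2020, Thm 5.2 (proof)] -/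
noncomputable def lpAdvDist : RandAlg (List Bool) Bool where
  run := lpAdvRun H γ Q K
  coinLen Λ := lpAdvCoins H γ Q K adv (lpSeedOf (lpInner γ) Λ)

/-- The coin budget of `D` on `⟨1ⁿ, y⟩`, `|y| = ℓ_F(n)`. [folklore] -/
theorem lpAdvDist_coinLen (n : ℕ) :
    (lpAdvDist H γ Q K adv).coinLen (2 * n + 2 + lpInner γ n) = lpAdvCoins H γ Q K adv n := by
  simp only [lpAdvDist]
  rw [lpSeedOf_eq]
  intro n' hn'
  have := lpInner_mono γ hn'.le
  omega

variable {H γ Q K adv}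

/-- Decoding the outer length from the coin count. [folklore] -/
theorem lpCand_lpAdvCoins {n : ℕ} (hK : H.coinLen (lpInner γ n + (lpLo γ Q n + adv n - n)) < K n) :
    lpOuter γ Q K n (lpAdvCoins H γ Q K adv n) = lpLo γ Q n + adv n := by
  unfold lpOuter lpAdvCoins
  have hK0 : 0 < K n := by omega
  rw [Nat.add_assoc, Nat.add_sub_cancel_left, Nat.add_comm (adv n * K n), Nat.add_mul_div_right _ _ hK0,
    Nat.div_eq_of_lt hK, Nat.zero_add]

/-- Decoding `ℋ`'s coin count from the coin count. [folklore] -/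
theorem lpKap_lpAdvCoins {n : ℕ} (hK : H.coinLen (lpInner γ n + (lpLo γ Q n + adv n - n)) < K n) :
    lpKap Q K n (lpAdvCoins H γ Q K adv n) = H.coinLen (lpInner γ n + (lpLo γ Q n + adv n - n)) := by
  unfold lpKap lpAdvCoins
  rw [Nat.add_assoc, Nat.add_sub_cancel_left, Nat.add_comm, Nat.add_mul_mod_self_right,
    Nat.mod_eq_of_lt hK]

/-- The deterministic core on a well-formed input `⟨1ⁿ, y⟩`. [folklore] -/
@[simp] theorem lpAdvRun_boolPair (n : ℕ) (y r : List Bool) :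
    lpAdvRun H γ Q K (boolPair (unaryEncodeNat n) y) r =
      lpTest H n (y ++ r.take (lpOuter γ Q K n r.length - n))
        (r.drop (r.length - lpKap Q K n r.length)) := by
  simp [lpAdvRun]

/-- **Acceptance probability of the padding distinguisher**: on `⟨1ⁿ, y⟩`, `|y| = ℓ_F(n)`, with
advice `i = adv(n)` decodable (`K(n)` exceeds `ℋ`'s coin count, the padding fits into `Q(n+1)`
coins), `Pr_r[D(1ⁿ, y; r) = 1] = E_{τ ← U_{N-n}}[Pr_ρ[ℋ(y ‖ τ; ρ) ≥ |y ‖ τ| - 3⌊log₂ n⌋]]`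
(`= padAcc`), `N = Q(n) - γ - 1 + i`: the padding coins, the unused middle coins and `ℋ`'s coins
are independent uniform fields of the coin string. [folklore] -/
theorem lpAdvDist_pr_eq {n : ℕ} (y : List Bool) (hy : y.length = lpInner γ n)
    (hK : H.coinLen (lpInner γ n + (lpLo γ Q n + adv n - n)) < K n)
    (hpad : lpLo γ Q n + adv n - n ≤ Q (n + 1)) :
    (lpAdvDist H γ Q K adv).pr id (boolPair (unaryEncodeNat n) y) {true} =
      padAcc H n (lpLo γ Q n + adv n) y := by
  have hκC : (lpAdvDist H γ Q K adv).coinLen (id (boolPair (unaryEncodeNat n) y)).length =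
      lpAdvCoins H γ Q K adv n := by
    simp only [id, length_boolPair, length_unaryEncodeNat, hy]
    exact lpAdvDist_coinLen H γ Q K adv n
  rw [(lpAdvDist H γ Q K adv).pr_true_eq_uniformAvg id _ hκC]
  -- names
  have hCeq : lpAdvCoins H γ Q K adv n = (lpLo γ Q n + adv n - n) +
      ((Q (n + 1) - (lpLo γ Q n + adv n - n) + adv n * K n) +
        H.coinLen (lpInner γ n + (lpLo γ Q n + adv n - n))) := by
    unfold lpAdvCoins
    omega
  -- the integrand on coin strings of the right length
  have hint : ∀ r : List Bool, r.length = lpAdvCoins H γ Q K adv n →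
      (if (lpAdvDist H γ Q K adv).run (boolPair (unaryEncodeNat n) y) r = true then (1 : ℝ) else 0) =
        (fun u w => if lpTest H n (y ++ u)
            (w.drop (Q (n + 1) - (lpLo γ Q n + adv n - n) + adv n * K n)) = true then (1 : ℝ) else 0)
          (r.take (lpLo γ Q n + adv n - n)) (r.drop (lpLo γ Q n + adv n - n)) := by
    intro r hr
    have hcand : lpOuter γ Q K n r.length = lpLo γ Q n + adv n := by rw [hr]; exact lpCand_lpAdvCoins hK
    have hkap : lpKap Q K n r.length = H.coinLen (lpInner γ n + (lpLo γ Q n + adv n - n)) := by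
      rw [hr]; exact lpKap_lpAdvCoins hK
    have hdrop : (r.drop (lpLo γ Q n + adv n - n)).drop
        (Q (n + 1) - (lpLo γ Q n + adv n - n) + adv n * K n) =
        r.drop (r.length - lpKap Q K n r.length) := by
      rw [List.drop_drop, hkap]
      congr 1
      omega
    simp only [lpAdvDist, lpAdvRun_boolPair, hcand, hdrop]
  rw [uniformAvg_congr hint, hCeq,
    uniformAvg_add (lpLo γ Q n + adv n - n) _ (fun u w => if lpTest H n (y ++ u)
      (w.drop (Q (n + 1) - (lpLo γ Q n + adv n - n) + adv n * K n)) = true then (1 : ℝ) else 0)]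
  unfold padAcc
  refine uniformAvg_congr fun u hu => ?_
  rw [show (fun w : List Bool => if lpTest H n (y ++ u)
        (w.drop (Q (n + 1) - (lpLo γ Q n + adv n - n) + adv n * K n)) = true then (1 : ℝ) else 0) =
      fun w => (fun (_ : List Bool) (ρ : List Bool) =>
        if lpTest H n (y ++ u) ρ = true then (1 : ℝ) else 0)
        (w.take (Q (n + 1) - (lpLo γ Q n + adv n - n) + adv n * K n))
        (w.drop (Q (n + 1) - (lpLo γ Q n + adv n - n) + adv n * K n)) from rfl,
    uniformAvg_add (Q (n + 1) - (lpLo γ Q n + adv n - n) + adv n * K n) _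
      (fun (_ : List Bool) (ρ : List Bool) =>
        if lpTest H n (y ++ u) ρ = true then (1 : ℝ) else 0),
    uniformAvg_const]
  exact uniformAvg_lpTest _ (y ++ u) (by simp [hy, hu])

/-- On the uniform ensemble: `Pr[D(1ⁿ, U_{ℓ_F(n)}) = 1] = uAcc` (a uniform sample padded with
uniform coins is uniform). [folklore] -/
theorem toReal_acceptPMF_lpAdvDist_uniform {n : ℕ}
    (hK : H.coinLen (lpInner γ n + (lpLo γ Q n + adv n - n)) < K n)
    (hpad : lpLo γ Q n + adv n - n ≤ Q (n + 1)) :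
    (acceptPMF (lpAdvDist H γ Q K adv) n (uniformBits (lpInner γ n)) true).toReal =
      uAcc H γ n (lpLo γ Q n + adv n) := by
  rw [toReal_acceptPMF_uniformBits,
    uniformAvg_congr fun y hy => lpAdvDist_pr_eq (H := H) (γ := γ) (Q := Q) (K := K) (adv := adv) y hy hK hpad]
  exact uniformAvg_padAcc n _

/-- On the generator ensemble: `Pr[D(1ⁿ, F(U_S)) = 1] = gAcc`. [folklore] -/
theorem toReal_acceptPMF_lpAdvDist_gen {n : ℕ} {S : Finset (List Bool)} (hS : S.Nonempty)
    (F : List Bool → List Bool) (hFlen : ∀ s ∈ S, (F s).length = lpInner γ n)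
    (hK : H.coinLen (lpInner γ n + (lpLo γ Q n + adv n - n)) < K n)
    (hpad : lpLo γ Q n + adv n - n ≤ Q (n + 1)) :
    (acceptPMF (lpAdvDist H γ Q K adv) n ((condUniform S).map F) true).toReal =
      gAcc H F S n (lpLo γ Q n + adv n) := by
  rw [toReal_acceptPMF_condUniform_map _ n hS F,
    Finset.sum_congr rfl fun s hs =>
      lpAdvDist_pr_eq (H := H) (γ := γ) (Q := Q) (K := K) (adv := adv) (F s) (hFlen s hs) hK hpad]
  rfl

end AdviceDistinguisher

section Core

variable {U : UniversalMachine} {t : Polynomial ℕ}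

/-- **Liu–Pass's Thm 5.2 relative to the inner cond EP-PRG of Thm 5.5, core.** Let `F` be a
`μ`-cond EP-PRG `{0,1}^n → {0,1}^{n + γ⌊log₂ n⌋}` with events `E_n` and entropy loss `α`, and let
`ℋ` be a heuristic for `K^t`. Suppose: the padding distinguishers `D_{ℋ,γ,Q,K,adv}` are PPT for
every polynomially bounded advice; `Q(n) ≥ n + γ + 1` eventually; `K(n)` exceeds `ℋ`'s coin count
on all padded lengths; `μ(n) ≤ 1/(2(α+1)n)` eventually; the padded outputs `F(s) ‖ τ` have low
`K^t`-complexity, `K^t(F(s) ‖ τ) + 3⌊log₂ n⌋ < |F(s) ‖ τ|`, for every outer length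
`N ∈ [Q(n) - γ - 1, Q(n+1))` (print's eq. (2)); and `K^t` is finite on long strings. Then `ℋ` does
**not** beat `1 - 1/p(m)`, `p(m) = m^{α+γ+3} + 1`, at infinitely many lengths `m`: otherwise
infinitely many inner lengths `n` have a good outer length (`frequently_exists_candidate`), the
advice selects it, and there `Pr[D(U) = 1] - Pr[D(F(U_{E_n})) = 1] = uAcc - gAcc ≥ 1/(2(α+1)n)
≥ μ(n)` (Claims 1–2 of print's proof: `le_uAcc`, `gAcc_le`, `gap_ge`; print: "`≥ 1/n - 4/n² ≥
1/n²`"), contradicting `μ`-pseudorandomness of `F`. [Y. Liu, R. Pass, FOCS 2020, proof of Thm 5.2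
with the padding of Thms 5.5–5.6, in the tree's model] [cite: LiuPassFOCS2020, Thm 5.2 (proof)] -/
theorem not_frequently_good_of_inner {F : List Bool → List Bool} {E : ℕ → Finset (List Bool)}
    {γ α : ℕ} {μ : ℕ → ℝ} (hF : IsCondEPPRG μ F E (lpInner γ) α)
    (H : RandAlg (List Bool) ℕ) {Q K : ℕ → ℕ}
    (hD : ∀ adv : ℕ → ℕ, (∀ n, adv n ≤ Q (n + 1)) → IsPPT (lpAdvDist H γ Q K adv) encodeBool)
    {n₁ : ℕ} (hQ : ∀ n, n₁ ≤ n → n + (γ + 1) ≤ Q n)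
    (hKbig : ∀ᶠ n in atTop, ∀ m ≤ lpInner γ n + Q (n + 1), H.coinLen m < K n)
    (hμ : ∀ᶠ n in atTop, μ n ≤ 1 / (2 * ((α : ℝ) + 1) * n))
    (hKt : ∀ᶠ n in atTop, ∀ i < lpW γ Q n, ∀ s ∈ E n, ∀ τ : List Bool,
      τ.length = lpLo γ Q n + i - n →
        liuPassKt U t (F s ++ τ) + 3 * Nat.log 2 n < lpInner γ n + (lpLo γ Q n + i - n))
    (hfin : ∃ n₀, ∀ x : List Bool, n₀ ≤ x.length → U.ktAt (t.eval x.length) x < ⊤) :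
    ¬ ∃ᶠ m in atTop, 1 - 1 / (((m ^ (α + γ + 3) + 1 : ℕ) : ℝ)) <
        avgSuccessProb (liuPassKt U t) H m := by
  classical
  intro hfreq
  -- good outer lengths for `ℋ` at inner length `n`, and the advice selecting one
  let good : ℕ → ℕ → Prop := fun n i => i < lpW γ Q n ∧
    1 - 1 / ((((lpInner γ n + (lpLo γ Q n + i - n)) ^ (α + γ + 3) + 1 : ℕ) : ℝ)) <
      avgSuccessProb (liuPassKt U t) H (lpInner γ n + (lpLo γ Q n + i - n))
  obtain ⟨adv, hadv_spec, hadv_le⟩ : ∃ adv : ℕ → ℕ,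
      (∀ n, (∃ i, good n i) → good n (adv n)) ∧ (∀ n, adv n ≤ Q (n + 1)) := by
    refine ⟨fun n => if h : ∃ i, good n i then Nat.find h else 0, fun n h => ?_, fun n => ?_⟩
    · simp only [dif_pos h]
      exact Nat.find_spec h
    · by_cases h : ∃ i, good n i
      · simp only [dif_pos h]
        have h1 : Nat.find h < lpW γ Q n := (Nat.find_spec h).1
        simp only [lpW] at h1
        omega
      · simp only [dif_neg h]
        exact Nat.zero_le _
  -- infinitely many inner lengths have a good outer length
  have hfreqn : ∃ᶠ n in atTop, ∃ i, good n i := by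
    refine (frequently_exists_candidate γ Q hQ hfreq).mono ?_
    rintro n ⟨i, hi, hgi⟩
    exact ⟨i, hi, hgi⟩
  -- pseudorandomness of `F` against the padding distinguisher with this advice
  have hpr := hF.pseudorandom (hD adv hadv_le)
  obtain ⟨n₀, hn₀⟩ := hfin
  have hev : ∀ᶠ n in atTop, (∃ i, good n i) →
      μ n ≤ distAdvantage (lpAdvDist H γ Q K adv) (condEnsemble F E) (uniformEnsemble (lpInner γ)) n := by
    filter_upwards [eventually_ge_atTop n₁, eventually_ge_atTop n₀, eventually_ge_atTop 16,
      eventually_ge_atTop (22 * (α + 1)), hKbig, hμ, hKt, hF.length_out, hF.entropy]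
      with n hn₁ hnn₀ hn16 hnα hKn hμn hKtn hlen hent hex
    have hg := hadv_spec n hex
    have hQn := hQ n hn₁
    have hiW : adv n < Q (n + 1) - lpLo γ Q n := hg.1
    -- the selected outer length `N` and its bookkeeping
    obtain ⟨N, hN⟩ : ∃ N, lpLo γ Q n + adv n = N := ⟨_, rfl⟩
    have hNQ : N < Q (n + 1) := hN ▸ Nat.lt_sub_iff_add_lt'.1 hiW
    have hLo : n ≤ lpLo γ Q n := Nat.le_sub_of_add_le hQn
    have hnN : n ≤ N := by rw [← hN]; omega
    have hn0 : 0 < n := by omega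
    have hpad : N - n ≤ Q (n + 1) := (Nat.sub_le _ _).trans hNQ.le
    have hnm : n ≤ lpInner γ n + (N - n) := by
      show n ≤ n + γ * Nat.log 2 n + (N - n)
      omega
    have hK : H.coinLen (lpInner γ n + (N - n)) < K n := hKn _ (Nat.add_le_add_left hpad _)
    have hS := hF.nonempty n
    have hFlenS : ∀ s ∈ E n, (F s).length = lpInner γ n := fun s hs => hlen s (hF.length_eq hs)
    have hK' : H.coinLen (lpInner γ n + (lpLo γ Q n + adv n - n)) < K n := by rw [hN]; exact hK
    have hpad' : lpLo γ Q n + adv n - n ≤ Q (n + 1) := by rw [hN]; exact hpad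
    have hU : (acceptPMF (lpAdvDist H γ Q K adv) n (uniformEnsemble (lpInner γ) n) true).toReal =
        uAcc H γ n N := by
      rw [← hN]; exact toReal_acceptPMF_lpAdvDist_uniform hK' hpad'
    have hG : (acceptPMF (lpAdvDist H γ Q K adv) n (condEnsemble F E n) true).toReal =
        gAcc H F (E n) n N := by
      rw [← hN]; exact toReal_acceptPMF_lpAdvDist_gen hS F hFlenS hK' hpad'
    have hu := le_uAcc (H := H) (γ := γ) (N := N) hn16 hnn₀ hn₀
    have hgle := gAcc_le (H := H) (t := t) hS (fun s hs => hF.length_eq hs) hn0 hnN F hlen hent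
      (fun s hs τ hτ => by
        have h := hKtn (adv n) hiW s hs τ (by rw [hN]; exact hτ)
        rwa [hN] at h)
    have h1n : (1 : ℝ) ≤ n := by exact_mod_cast hn0
    have ha : (0 : ℝ) ≤ α * Real.logb 2 n :=
      mul_nonneg (Nat.cast_nonneg α) (Real.logb_nonneg one_lt_two h1n)
    have ha1 : α * Real.logb 2 n + 1 ≤ ((α : ℝ) + 1) * n := by
      have hlb := logb_two_natCast_le hn0
      calc α * Real.logb 2 n + 1 ≤ α * n + n :=
            add_le_add (mul_le_mul_of_nonneg_left hlb (Nat.cast_nonneg α)) h1n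
        _ = ((α : ℝ) + 1) * n := by ring
    have hP : (n : ℝ) ^ (α + γ + 3) <
        (((lpInner γ n + (N - n)) ^ (α + γ + 3) + 1 : ℕ) : ℝ) := by
      have : n ^ (α + γ + 3) ≤ (lpInner γ n + (N - n)) ^ (α + γ + 3) := Nat.pow_le_pow_left hnm _
      exact_mod_cast Nat.lt_succ_of_le this
    have hgood : 1 - 1 / ((((lpInner γ n + (N - n)) ^ (α + γ + 3) + 1 : ℕ) : ℝ)) <
        avgSuccessProb (liuPassKt U t) H (lpInner γ n + (N - n)) := by
      have h := hg.2
      rwa [hN] at h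
    have hgap := gap_ge hnα ha ha1 hP hgood hu hgle
    rw [distAdvantage, hG, hU]
    refine hμn.trans (hgap.trans (le_abs.2 (Or.inr ?_)))
    linarith
  obtain ⟨n, ⟨hex, himp⟩, hlt⟩ := ((hfreqn.and_eventually hev).and_eventually hpr).exists
  exact absurd (himp hex) (not_le.2 hlt)

end Core

section Facts

/-- **Liu–Pass 2020, Thm 5.5 (cond EP-PRGs from OWFs)**, named fact (D-0014). Print: "Assume that
one way functions exist. Then, there exists a polynomial `t₀(·)` such that for every `γ > 1`,
`δ > 1`, there exists a `(1/n^δ)`-condEP-PRG `G'_{δ,γ} : {0,1}^n → {0,1}^{n + γ log n}` with running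
time bounded by `(γ + δ) t₀(n)`." Rendering: `γ, δ` natural numbers `> 1`; output length
`n + γ⌊log₂ n⌋` (`lpInner γ`); "cond EP-PRG" in the sense of Def 5.1 as vendored (`IsCondEPPRG`:
polynomial-time `G`, nonempty events `E_n ⊆ {0,1}^n` at every `n`, `1/n^δ`-pseudorandomness of
`G(U_n | E_n)` against PPT distinguishers and Shannon entropy `≥ n - α log₂ n`, both for all large
`n`). Print's additional uniform running-time bound `(γ + δ) t₀(n)` (used in print only to make the
padding of Thm 5.6 rate-1) is **not** recorded, so this is the printed theorem minus that clause.
Not proved here: it is the HILL/Goldreich–Levin-type construction of §5.3 — Lemma 5.3 (implicit in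
[Gol01], [Yu]: a regular `S`-OWF gives a dense `f'` plus Goldreich–Levin hard-core bits, via
pairwise-independent hashing), Lemma 5.4 (every OWF is a regular `S`-OWF on sets `S_n` of density
`≥ 1/n`), the events `E_{n'} = {r(n)} × S_n × {0,1}^{3n^c}`, Lemma 2.x (statistical distance to
entropy) and the "extra bits" extension to all input lengths — with the self-contained proof of
Lemma 5.3 in the appendix of arXiv:2009.11514.
[Y. Liu, R. Pass, FOCS 2020, Thm 5.5; arXiv:2009.11514v1, §5.3 (Thm 5.5 with Lemmas 5.3–5.4)]
[cite: LiuPassFOCS2020, Thm 5.5] -/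
def condEPPRG_of_OWFExist : Prop :=
  OWFExist → ∀ γ δ : ℕ, 1 < γ → 1 < δ →
    ∃ (G : List Bool → List Bool) (E : ℕ → Finset (List Bool)) (α : ℕ),
      IsCondEPPRG (fun n : ℕ => 1 / (n : ℝ) ^ δ) G E (lpInner γ) α

/-- **Pass-through computation of a polynomial-time map** (efficiency fact, D-0014). For every
polynomial-time `F : {0,1}* → {0,1}*` there are a self-delimiting header `hdr(n)` of length
`≤ 2⌊log₂ n⌋ + c` (e.g. the bit-doubled binary representation of `n` followed by the separator
`01`, as in `Literature.Computability.Complexity.boolPair`), a TM2 machine `M` and a polynomial `T` such that on input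
`hdr(|s|) ‖ s ‖ σ` the machine outputs `F(s) ‖ σ` within `T(|s|)` steps *for every* `σ` — the
running time does not depend on the pass-through block. Realisation: a machine whose input stack
is its output stack (`k₀ = k₁`, as for Mathlib's `Turing.idComputer`) pops the header and then
`|s|` further symbols onto work stacks (binary counter), leaving `σ` untouched below; runs a
polynomial-time machine for `F` on `s`, that machine's stacks being extra stacks of `M`; pushes
`F(s)` back on top of `σ` and empties the work stacks (`Turing.haltList`). This is the
stack-machine form of the padded generator `G_γ(s₀ ‖ s₁) = s₀ ‖ G'(s₁)` of the proof of Liu–Pass's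
Thm 5.6 and of the "extra bits … appended to the output" in the proof of Thm 5.5, with the block
order mirrored to the stack discipline; combined with `UniversalMachine.sim` it gives
`K^t(F(s) ‖ σ) ≤ |s| + |σ| + O(log |s|)` at every budget `t ≥ p(T(|s|))`
(`UniversalMachine.exists_ktAt_passThrough_le`), the tree's substitute for print's eq. (2) of the
proof of Thm 5.2. Not proved: routine but long TM2 programming (header parsing, a counter,
sequential composition with relocated stacks) that the tree does not have.
[Y. Liu, R. Pass, FOCS 2020, proof of Thm 5.6 and proof of Thm 5.5 (extension to all input
lengths); S. Arora, B. Barak, *Computational Complexity*, CUP 2009, §1.2–1.3, Thm 1.9]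
[cite: LiuPassFOCS2020, Thm 5.6 (proof)] -/
def passThrough_polyTime : Prop :=
  ∀ F : List Bool → List Bool, PolyTimeComputable id id F →
    ∃ (hdr : ℕ → List Bool) (c : ℕ) (M : Turing.TM2ComputableAux Bool Bool) (T : Polynomial ℕ),
      (∀ n, (hdr n).length ≤ 2 * Nat.log 2 n + c) ∧
      ∀ s σ : List Bool, M.OutputsWithin (hdr s.length ++ s ++ σ) (F s ++ σ) (T.eval s.length)

/-- **Efficiency of the padding distinguisher** (efficiency fact, D-0014). For every PPT heuristic
`ℋ` (natural-number output in binary), every `γ` and all polynomials `Q, K`, the deterministic core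
`(⟨1ⁿ, y⟩, r) ↦ lpAdvRun ℋ γ Q K ⟨1ⁿ, y⟩ r` of `lpAdvDist` is polynomial-time computable in the
tree's TM2 sense: one `boolUnpair`; the arithmetic `Q(n)`, `Q(n+1)`, `K(n)`, `|r|`, the division
with remainder `|r| - Q(n+1) = i · K(n) + κ` and `N = Q(n) - γ - 1 + i` on numbers of polynomial
length; the list operations `x = y ‖ r.take (N - n)` and `ρ = r.drop (|r| - κ)`; one call
`ℋ.run x ρ` (polynomial time on *all* input/coin pairs, Gill-style `RandAlg.IsPolyTime`); the
threshold `|x| - 3⌊log₂ n⌋` and a comparison with `ℋ`'s binary output. Same status as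
`liuPassDistRun_polyTime` (print's distinguisher without the padding): closure of
`PolyTimeComputable` under composition (`PolyTimeComputable.comp_holds`) and
`polyTimeComputable_boolUnpair` are in the tree, the listed arithmetic and list routines as TM2
machines are not. [Y. Liu, R. Pass, FOCS 2020, proof of Thm 5.2 ("we now construct a PPT
distinguisher `𝒜`"); S. Arora, B. Barak, CUP 2009, Thm 1.9 and §7.1]
[cite: LiuPassFOCS2020, Thm 5.2 (proof)] -/
def lpAdvRun_polyTime : Prop :=
  ∀ H : RandAlg (List Bool) ℕ, IsPPT H encodeNat → ∀ (γ : ℕ) (Q K : Polynomial ℕ),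
    PolyTimeComputable (fun p : List Bool × List Bool => boolPair p.1 p.2) encodeBool
      (Function.uncurry (lpAdvRun H γ (fun n => Q.eval n) (fun n => K.eval n)))

end Facts

section Assembly

/-- Monotonicity of `ℕ`-polynomial evaluation (private copy, cf. `LiuPassCondEPPRG.lean`).
[folklore] -/
private theorem natPoly_eval_mono' (p : Polynomial ℕ) {a b : ℕ} (hab : a ≤ b) :
    p.eval a ≤ p.eval b := by
  rw [Polynomial.eval_eq_sum_range, Polynomial.eval_eq_sum_range]
  exact Finset.sum_le_sum fun i _ => Nat.mul_le_mul_left _ (Nat.pow_le_pow_left hab i)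

/-- The recovered security parameter never exceeds the input length. [folklore] -/
theorem lpSeedOf_le (ℓ : ℕ → ℕ) (Λ : ℕ) : lpSeedOf ℓ Λ ≤ Λ := by
  classical
  by_cases h : ∃ n, 2 * n + 2 + ℓ n = Λ
  · rw [lpSeedOf, dif_pos h]
    have := Nat.find_spec h
    omega
  · rw [lpSeedOf, dif_neg h]
    exact Nat.zero_le _

/-- **S02, direction `→`, for every `U` and every polynomial `t(n) ≥ (1+ε)n, from Thm 5.5 and two
efficiency facts** (Liu–Pass 2020, Thm 3.1 (a) ⇒ (c) specialised to exact computation = the remark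
after Thm 3.1; in print via Thms 5.5, 5.6, 5.2). Given one-way functions: take the `1/n²`-cond
EP-PRG `F : {0,1}^n → {0,1}^{n + 6⌊log₂ n⌋}` of Thm 5.5 (`γ = 6`, `δ = 2`), a pass-through machine
`M` for `F` (`passThrough_polyTime`) with code `e` and simulation overhead `p` on `U`
(`UniversalMachine.sim`), and pad to the outer seed lengths `N ∈ [Q(n) - 7, Q(n+1))`,
`Q(n) = p(T(n)) + n + 7`: then `K^{t(m)}(F(s) ‖ τ) ≤ |hdr(n)| + N + 2|e| + 2` because
`t(m) ≥ m ≥ N ≥ p(T(n))` (`UniversalMachine.exists_ktAt_le_of_outputsWithin`, `ktAt_anti`), which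
is below the threshold margin `6⌊log₂ n⌋ - 3⌊log₂ n⌋` once `⌊log₂ n⌋ > c + 2|e| + 2` — print's
eq. (2). The core `not_frequently_good_of_inner` (Thm 5.2's Claims 1–2 for the padded generator,
the padding distinguisher `lpAdvDist` being PPT by `lpAdvRun_polyTime` with coin-count polynomial
`K(n) = q_ℋ(7n + Q(n) + Q(n+1)) + 1`) then shows that no PPT heuristic computes `K^t` on a
`1 - 1/p(m)` fraction of `U_m` for infinitely many `m`, `p(m) = m^{α+9} + 1`.
[Y. Liu, R. Pass, FOCS 2020, Thm 3.1 (a) ⇒ (c) and the remark following it; Thms 5.2, 5.5, 5.6;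
arXiv:2009.11514v1] [cite: LiuPassFOCS2020, Thm 3.1 (a)⇒(c) and remark; Thm 5.2; Thm 5.5; Thm 5.6] -/
theorem isMildlyHardOnAverage_liuPassKt_of_OWFExist_of_padding (h55 : condEPPRG_of_OWFExist)
    (hpass : passThrough_polyTime) (hadv : lpAdvRun_polyTime) (U : UniversalMachine)
    (t : Polynomial ℕ) {ε : ℝ} (hε : 0 < ε) (ht : ∀ n : ℕ, (1 + ε) * n ≤ ((t.eval n : ℕ) : ℝ))
    (hO : OWFExist) : IsMildlyHardOnAverage encodeNat (liuPassKt U t) := by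
  classical
  -- Thm 5.5 with `γ = 6`, `δ = 2`
  obtain ⟨F, E, α, hF⟩ := h55 hO 6 2 (by norm_num) (by norm_num)
  -- the pass-through machine for `F`, its code and overhead on `U`
  obtain ⟨hdr, c, M, T, hhdr, hM⟩ := hpass F hF.polyTimeComputable
  obtain ⟨e, p, hsim⟩ := U.exists_ktAt_le_of_outputsWithin M
  -- the outer-length polynomial `Q(n) = p(T(n)) + n + 7`
  set Qp : Polynomial ℕ := p.comp T + Polynomial.X + Polynomial.C (6 + 1) with hQp
  set Q : ℕ → ℕ := fun n => Qp.eval n with hQdef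
  have hQeval : ∀ n, Q n = p.eval (T.eval n) + n + (6 + 1) := fun n => by
    simp [hQdef, hQp, Polynomial.eval_comp]
  have hQ : ∀ n, 0 ≤ n → n + (6 + 1) ≤ Q n := fun n _ => by rw [hQeval]; omega
  -- finiteness of `K^t` and `t(m) ≥ m`
  obtain ⟨n₀, hn₀⟩ := U.kt_lt_top_of_le hε
  have hfin : ∃ n₀, ∀ x : List Bool, n₀ ≤ x.length → U.ktAt (t.eval x.length) x < ⊤ :=
    ⟨n₀, fun x hx => hn₀ x hx _ (Nat.ceil_le.2 (ht x.length))⟩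
  have htm : ∀ m : ℕ, m ≤ t.eval m := fun m => by
    have h1 := ht m
    have h0 : (0 : ℝ) ≤ m := Nat.cast_nonneg m
    have h2 : (m : ℝ) ≤ (1 + ε) * m := by nlinarith
    exact_mod_cast h2.trans h1
  -- low `K^t`-complexity of the padded outputs (print's eq. (2), for the tree's `U`)
  have hKt : ∀ᶠ n in atTop, ∀ i < lpW 6 Q n, ∀ s ∈ E n, ∀ τ : List Bool,
      τ.length = lpLo 6 Q n + i - n →
        liuPassKt U t (F s ++ τ) + 3 * Nat.log 2 n < lpInner 6 n + (lpLo 6 Q n + i - n) := by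
    filter_upwards [hF.length_out, eventually_ge_atTop (2 ^ (c + 2 * e.length + 3))]
      with n hlen hn i _hi s hs τ hτ
    have hLge : c + 2 * e.length + 3 ≤ Nat.log 2 n := Nat.le_log_of_pow_le one_lt_two hn
    have hQn := hQeval n
    have hslen : s.length = n := hF.length_eq hs
    have hFs : (F s).length = lpInner 6 n := hlen s hslen
    have hLo : n + p.eval (T.eval n) ≤ lpLo 6 Q n := by
      simp only [lpLo, hQn]
      omega
    have hxlen : (F s ++ τ).length = lpInner 6 n + (lpLo 6 Q n + i - n) := by
      rw [List.length_append, hFs, hτ]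
    -- the budget `t(m)` covers the simulation: `p(T(n)) ≤ N ≤ m ≤ t(m)`
    have hbudget : p.eval (T.eval n) ≤ t.eval (F s ++ τ).length := by
      rw [hxlen]
      refine le_trans ?_ (htm _)
      simp only [lpInner]
      omega
    have hkt1 : U.ktAt (p.eval (T.eval n)) (F s ++ τ) ≤
        (((hdr n ++ s ++ τ).length + (2 * e.length + 2) : ℕ) : ℕ∞) := by
      have := hsim _ _ _ (hM s τ)
      rw [hslen] at this
      exact_mod_cast this
    have hval : liuPassKt U t (F s ++ τ) ≤ (hdr n ++ s ++ τ).length + (2 * e.length + 2) := by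
      rw [liuPassKt_def]
      exact ENat.toNat_le_of_le_coe ((U.ktAt_anti hbudget _).trans hkt1)
    have hhn := hhdr n
    simp only [List.length_append, hslen, hτ] at hval
    simp only [lpInner]
    omega
  -- `μ(n) = 1/n² ≤ 1/(2(α+1)n)` eventually
  have hμ : ∀ᶠ n : ℕ in atTop, (1 : ℝ) / (n : ℝ) ^ 2 ≤ 1 / (2 * ((α : ℝ) + 1) * n) := by
    filter_upwards [eventually_ge_atTop (2 * (α + 1)), eventually_ge_atTop 1] with n hn hn1
    have hnR : (2 : ℝ) * ((α : ℝ) + 1) ≤ n := by exact_mod_cast hn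
    have hn0 : (0 : ℝ) < n := by exact_mod_cast hn1
    rw [one_div_le_one_div (by positivity) (by positivity), pow_two]
    exact mul_le_mul_of_nonneg_right hnR hn0.le
  -- the hardness polynomial `p(m) = m^{α+9} + 1`
  have hpe : ∀ m : ℕ, (Polynomial.X ^ (α + 6 + 3) + 1 : Polynomial ℕ).eval m = m ^ (α + 6 + 3) + 1 :=
    fun m => by simp
  refine ⟨Polynomial.X ^ (α + 6 + 3) + 1, fun n => by rw [hpe]; positivity, fun H hH => ?_⟩
  -- `ℋ`'s coin polynomial and the decoding modulus `K(n) = q(7n + Q(n) + Q(n+1)) + 1`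
  obtain ⟨q, hq⟩ := hH.2
  set Kp : Polynomial ℕ :=
    q.comp (Polynomial.C (6 + 1) * Polynomial.X + Qp + Qp.comp (Polynomial.X + 1)) + 1 with hKp
  set K : ℕ → ℕ := fun n => Kp.eval n with hKdef
  have hKeval : ∀ n, K n = q.eval ((6 + 1) * n + Q n + Q (n + 1)) + 1 := fun n => by
    simp [hKdef, hKp, hQdef, Polynomial.eval_comp]
  have hInner : ∀ n, lpInner 6 n ≤ (6 + 1) * n := fun n => by
    have := Nat.log_le_self 2 n
    simp only [lpInner]
    omega
  have hKbig' : ∀ n, ∀ m ≤ lpInner 6 n + Q n + Q (n + 1), H.coinLen m < K n := by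
    intro n m hm
    rw [hKeval]
    have h2 : H.coinLen m ≤ q.eval ((6 + 1) * n + Q n + Q (n + 1)) :=
      (hq m).trans (natPoly_eval_mono' q (by have := hInner n; omega))
    omega
  have hKbig : ∀ᶠ n in atTop, ∀ m ≤ lpInner 6 n + Q (n + 1), H.coinLen m < K n :=
    Eventually.of_forall fun n m hm => hKbig' n m (by omega)
  -- the padding distinguishers are PPT (efficiency fact + a polynomial coin bound)
  have hD : ∀ adv : ℕ → ℕ, (∀ n, adv n ≤ Q (n + 1)) → IsPPT (lpAdvDist H 6 Q K adv) encodeBool := by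
    intro adv hadvle
    refine ⟨hadv H hH 6 Qp Kp, Qp.comp (Polynomial.X + 1) * (Kp + 1) + Kp, fun Λ => ?_⟩
    have hP : ∀ n, (Qp.comp (Polynomial.X + 1) * (Kp + 1) + Kp).eval n = Q (n + 1) * (K n + 1) + K n :=
      fun n => by simp [hQdef, hKdef, Polynomial.eval_comp]
    set ns := lpSeedOf (lpInner 6) Λ with hns
    have hnsΛ : ns ≤ Λ := lpSeedOf_le _ _
    refine le_trans ?_ (natPoly_eval_mono' _ hnsΛ)
    rw [hP]
    show lpAdvCoins H 6 Q K adv ns ≤ Q (ns + 1) * (K ns + 1) + K ns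
    unfold lpAdvCoins
    have h1 : adv ns ≤ Q (ns + 1) := hadvle ns
    have hlo : lpLo 6 Q ns ≤ Q ns := Nat.sub_le _ _
    have h2 : H.coinLen (lpInner 6 ns + (lpLo 6 Q ns + adv ns - ns)) < K ns :=
      hKbig' ns _ (by omega)
    have h3 : adv ns * K ns ≤ Q (ns + 1) * K ns := Nat.mul_le_mul_right _ h1
    nlinarith
  -- suppose `ℋ` beats `1 - 1/p(m)` infinitely often: contradiction with the core
  by_contra hnot
  have hfreq : ∃ᶠ m in atTop, 1 - 1 / (((m ^ (α + 6 + 3) + 1 : ℕ) : ℝ)) <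
      avgSuccessProb (liuPassKt U t) H m := by
    rw [Filter.not_eventually] at hnot
    refine hnot.mono fun m hm => ?_
    rw [hpe] at hm
    exact not_le.1 hm
  exact not_frequently_good_of_inner hF H hD (n₁ := 0) hQ hKbig hμ hKt hfin hfreq

/-- **The forward fact of `Sweep1Proofs.lean` from the three facts**: OWFs ⇒ `K^t` mildly
hard-on-average for every `U` and every polynomial `t(n) ≥ (1+ε)n`
(`isMildlyHardOnAverage_liuPassKt_of_OWFExist`, the remark after Liu–Pass's Thm 3.1), now resting on
Thm 5.5 (`condEPPRG_of_OWFExist`) and the efficiency facts `passThrough_polyTime`,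
`lpAdvRun_polyTime`; this supersedes the composite fact `condEPPRG_family_of_OWFExist` of
`LiuPassCondEPPRG.lean`. [Y. Liu, R. Pass, FOCS 2020, Thm 3.1 (a) ⇒ (c) and remark; arXiv:2009.11514]
[cite: LiuPassFOCS2020, Thm 3.1 (a)⇒(c) and remark] -/
theorem isMildlyHardOnAverage_liuPassKt_of_OWFExist_of_facts (h55 : condEPPRG_of_OWFExist)
    (hpass : passThrough_polyTime) (hadv : lpAdvRun_polyTime) :
    isMildlyHardOnAverage_liuPassKt_of_OWFExist :=
  fun U t _ hε ht hO => isMildlyHardOnAverage_liuPassKt_of_OWFExist_of_padding h55 hpass hadv U t hε ht hO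

/-- **Liu–Pass 2020, Thm 3.1 (a) ⇒ (b)** (the fact
`exists_isMildlyHardOnAverage_liuPassKt_of_OWFExist` of `Sweep1Proofs.lean`) from the same three
facts. [Y. Liu, R. Pass, FOCS 2020, Thm 3.1; arXiv:2009.11514] [cite: LiuPassFOCS2020, Thm 3.1 (a)⇒(b)] -/
theorem exists_isMildlyHardOnAverage_liuPassKt_of_OWFExist_of_facts (h55 : condEPPRG_of_OWFExist)
    (hpass : passThrough_polyTime) (hadv : lpAdvRun_polyTime) :
    exists_isMildlyHardOnAverage_liuPassKt_of_OWFExist :=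
  exists_isMildlyHardOnAverage_liuPassKt_of_OWFExist_of_forward
    (isMildlyHardOnAverage_liuPassKt_of_OWFExist_of_facts h55 hpass hadv)

/-- **crypto-foundations.S02 (Liu–Pass 2020, Thm 1.1 / the remark after Thm 3.1) from named facts,
padding route.** For every efficient universal machine `U` and every polynomial `t(n) ≥ (1+ε)n`,
one-way functions exist iff `K^t` is mildly hard-on-average — from: the two efficiency facts of
Thm 4.1 (`liuPassOWF_polyTimeComputable`, `liuPassHeur_isPPT`; Thm 4.1 is otherwise proved in
`LiuPassWeakOWF.lean`), Yao's amplification (`weakOWFExist_iff_OWFExist`, S05), Thm 5.5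
(`condEPPRG_of_OWFExist`), and the two efficiency facts `passThrough_polyTime`,
`lpAdvRun_polyTime`; Thm 5.2 with the padding of Thm 5.6 is proved in `LiuPassCondEPPRG.lean` and
here. [Y. Liu, R. Pass, FOCS 2020, Thm 1.1 and the remark following Thm 3.1; arXiv:2009.11514]
[cite: LiuPassFOCS2020, Thm 1.1 (remark: every t ≥ (1+ε)n)] -/
theorem OWFExist_iff_isMildlyHardOnAverage_liuPassKt_of_facts'
    (hf : liuPassOWF_polyTimeComputable) (hH : liuPassHeur_isPPT) (hYao : weakOWFExist_iff_OWFExist)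
    (h55 : condEPPRG_of_OWFExist) (hpass : passThrough_polyTime) (hadv : lpAdvRun_polyTime) :
    OWFExist_iff_isMildlyHardOnAverage_liuPassKt :=
  OWFExist_iff_isMildlyHardOnAverage_liuPassKt_of_forward
    (weakOWFExist_of_isMildlyHardOnAverage_liuPassKt_of hf hH) hYao
    (isMildlyHardOnAverage_liuPassKt_of_OWFExist_of_facts h55 hpass hadv)

end Assembly

end Literature.Computability.Cryptography
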